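import Mathlib.Analysis.Fourier.FourierTransform
import Mathlib.Analysis.Calculus.ContDiff.Defs
import Mathlib.NumberTheory.ArithmeticFunction.VonMangoldt
import Mathlib.NumberTheory.DirichletCharacter.Basic
import Mathlib.Data.Nat.Totient
import Mathlib.MeasureTheory.Integral.IntervalIntegral.Basic
import Mathlib.Analysis.SpecialFunctions.SmoothTransition
import Mathlib.Analysis.SpecialFunctions.Pow.Asymptotics
import Literature.NumberTheory.LFunctions.SiegelZerosSmallZetaGaps
import Literature.NumberTheory.LFunctions.MontgomeryZeroWindows
import Literature.NumberTheory.LFunctions.ZetaFirstZeroCertificate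
import HarnessLib

/-!
# Bondarenko–Heap 2026, §2: the Montgomery–Odlyzko set-up with long Dirichlet polynomials
# (weights `W_T`, the small-gaps criterion, Proposition 1, the resonator, Theorems 3–4, eq. (8))

LABEL (cell `rh-crit`, corpus C5 `ah`): **NOT RH-BEARING.** Everything below is RH-FREE literature
(definitions, PROVED bookkeeping, and NAMED FACTS = claims of an unrefereed preprint taken as
hypotheses, never asserted); the two statements of the source that assume the Riemann Hypothesis
(Proposition 1 and equation (8)) carry Mathlib's `RiemannHypothesis` (for `ζ` ONLY) as an EXPLICIT
antecedent, and the exceptional character enters through the tree's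
`Literature.Barriers.Parity.IsSiegelZero`. Typing a printed conditional is transcription, not
progress toward RH; nothing here bears on the truth of RH, on the existence of Siegel zeros, or on
any alternative hypothesis. bears_on: LADDER-RH §4 HELD «conditional bridges: exceptional zero ⇒ …».

Topic `Literature/NumberTheory/LFunctions` (namespace `Literature.NumberTheory.LFunctions`; the
paper's internal objects live in the sub-namespace `BondarenkoHeap2026`). This is the STATEMENT
LAYER of §2 (pp. 4–9) of

* [BondarenkoHeap2026] A. Bondarenko, W. Heap, *Siegel zeros and small gaps between zeros of the
  Riemann zeta function*, arXiv:2608.07399v1 (7 Aug 2026) — UNREFEREED (claims `[status: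
  under-review]`); held text `paper:arxiv-2608.07399` (pypdf, 155 chunks; chunk `pNNNN` ↦ printed
  page given below), read 2026-08-26.

Its apex (Definition 1, Theorem 1, Corollary 2) is ALREADY typed in
`Literature/NumberTheory/LFunctions/SiegelZerosSmallZetaGaps.lean` (`bondarenkoHeap2026_theorem1`,
`SiegelZerosOfQuality`, `ZetaGapLiminfBelow`; cell parity-realchar) and is CITED, not restated. The
present file types the internal statements of §2 from which the paper deduces Theorem 1, so that
the apex claim can later be DISCHARGED from them (`theorem1_assembly`, an implication between the
typed internal statements and the existing apex decl; its proof is the "Proof of Theorem 1"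
paragraph of p. 9 and is prover work, not a hypothesis of anything).

## What the source prints (chunk ↦ page; every display quoted at its decl)

§2.1 (p0004–p0006 ↦ pp. 4–6): `N_h(t) := N(t + h/2) − N(t − h/2) = Σ_γ 1_{|t−γ| ≤ h/2}`,
`h = 2πc/log T` with `c > 0`; Fourier convention `F̂(ξ) = ∫ F(t) e^{−2πitξ} dt` (= Mathlib's `𝓕`);
"Fix `σ > 0` and a nonzero real even function `φ ∈ C_c^∞((−σ, σ))`, and let
`Φ(z) = ∫ φ(ξ) e^{2πizξ} dξ`, and (1) `W_T(z) = ((z² + 1/4)/T²)^B {Φ(z/T − 1)² + Φ(z/T + 1)²}` with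
`B ∈ ℕ` to be chosen. Then `W_T` is even and entire, `W_T(t) ≥ 0` for `t ∈ ℝ`, and (2)
`supp Ŵ_T ⊆ [−2σ/T, 2σ/T]`. Moreover (3) `Ŵ_T(0) = C_Φ T + O_{Φ,B}(T^{−1})` where
`C_Φ = ∫ x^{2B} {Φ(x−1)² + Φ(x+1)²} dx > 0`." Then `R(t) = Σ_{n ≤ L} r(n) n^{−1/2−it}`, "real
coefficients `r(n) ≪ n^ε` and `L ≤ T^C`", `I₁ = ∫_{T^{1−ε}}^{T^{1+ε}} N_h(t)|R(t)|² W_T(t) dt`,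
`I₀ = ∫_{T^{1−ε}}^{T^{1+ε}} |R(t)|² W_T(t) dt`; "• Small gaps criterion: If `I₁ > I₀` there exists a
`t ∈ [T^{1−ε}, T^{1+ε}]` for which `N_h(t) > 1`, thus giving a small gap of normalised size
`≤ c(1 + ε)`." p. 6: extension of both integrals to `ℝ` ("accounting for the symmetry of the
zeros") with `I₁/I₀ = Ĩ₁/Ĩ₀ + O(T^{−C})` ("we have assumed `I₀ ≫ 1`"), and (4)
`B_{T,h}(u) = ∫ 1_{|u−t| < h/2} |R(t)|² W_T(t) dt`, `I₁ = Σ_γ B_{T,h}(γ)`.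
§2.2 (p0007, p0015 ↦ p. 7): Guinand–Weil applied to `B_{T,h}` under RH (the tree's
`tsum_zeros_shift_eq_explicit`, `ExplicitFormulaBandLimited.lean`, is that formula — CITED), polar
terms `≪ T^{−C}`, Gamma integral `= h log|t| + o(1) = 2πc(1 + O₁(ε)) + o(1)`, and **Proposition 1**
(quoted at `proposition1`). §2.3 (p0015–p0017 ↦ pp. 7–9): the resonator `r(n) = χ(n) G(n)`,
`G(n) = G₀(log n/log L) f(n)`, parameters (5) `T = q^{7/3+δ}`, `L = T q^{1/2−δ} = q^{17/6}`,
`ϑ = ϑ_δ = log L/log T = 17/(14 + 6δ)`, `0 < δ < 10^{−2}`; **Theorem 3** ((6), (7)),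
**Theorem 4**, the "Proof of Theorem 1" with **(8)** and the fixed data `δ = 10^{−6}`,
`c = 0.473275`, `G₀(x) = 1 − (63/125)(x − 1/2)²`, "A computer calculation then shows that the right
hand side of (8) is `> 1` for `ε` sufficiently small and `E` sufficiently large."

## Lean rendering / design choices (binding for the sibling files of §§3–6)

* `N(t)` = tree `zetaZeroCount` (zeros with `0 < Im ρ ≤ t`, with multiplicity); `N_h` =
  `windowCount h t := N(t + h/2) − N(t − h/2)` (real-valued: no `ℕ`-subtraction). On the whole line
  the paper sums over ALL ordinates ("accounting for the symmetry of the zeros"); we render that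
  count as `symWindowCount h t := windowCount h t + windowCount h (−t)` (the conjugate zeros
  `ρ̄` have the same multiplicity, tree `riemannZetaZeroOrder_conj_holds`; the two half-open
  boundary conventions differ on a finite set of `t`, invisible to the integrals).
* Only REAL arguments of `Φ`, `W_T` occur in any printed STATEMENT of §2 (complex arguments occur
  inside the proof of Proposition 1 only), so `Φ` and `W_T` are typed as real functions of a real
  variable: `Phi w x := Re (𝓕⁻ φ)(x)` — the printed `∫ φ(ξ) e^{2πixξ} dξ` is Mathlib's `𝓕⁻ φ`,
  and it is real because `φ` is real and even (`Phi_eq`, proved) — and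
  `weight w B T t := ((t² + 1/4)/T²)^B (Φ(t/T − 1)² + Φ(t/T + 1)²)` (display (1),
  `\label{eq:entire-weight}`, TeX l.229–233 of the authors' source, cell copy
  `pub/rh-crit/ah/src-arxiv-2608.07399v1/`, which CONFIRMS the reading of the line-shredded pypdf
  extraction; it is also the reading forced by (3), since
  `∫ W_T = T ∫ (x² + 1/(4T²))^B {Φ(x−1)² + Φ(x+1)²} dx = C_Φ T + O(T^{−1})`). `Ŵ_T(ξ) := Re 𝓕(W_T)(ξ)`
  (`W_T` is real and even, so `𝓕 W_T` is real and even: `weightHat_eq`, `weightHat_even`, proved).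
  TeX line numbers `TeX l.N` below refer to that source (sha256/16 `c55a127ba83d8949`).
* `W_T ≥ 0` and `W_T` even are PROVED (`weight_nonneg`, `weight_even`); (2), (3) (and `C_Φ > 0`)
  are typed as named facts of calculus (`weightHat_support`, `weightHat_zero`, `cPhi_pos`).
* The small-gaps criterion is PROVED (`exists_one_lt_windowCount_of_I0_lt_I1`: if `I₁ > I₀` then
  `N_h(t) > 1` somewhere in the window, by monotonicity of the integral since `W_T ≥ 0`; and
  `exists_close_pair_of_one_lt_windowCount`: `N_h(t) ≥ 2` produces consecutive ordinates
  `t − h/2 < γ_m ≤ γ_{m+1} ≤ t + h/2`, via the tree's dictionary `γ_n ≤ t ↔ n < N(t)`), together with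
  the exact normalised consequence `δ_m ≤ c · log(T^{1+ε} + h/2)/log T` (`= c(1+ε) + O(1/(T log T))`,
  the printed "`≤ c(1+ε)`" up to the half-window at the right end point).
* Asymptotic notation. The source's `o(1)`, `O(·)`, `O₁(·)` ("`O₁` denotes an implicit constant of
  absolute value `≤ 1`", p. 7) are typed as EXPLICIT quantifier blocks in the printed shape and
  order — `∃` constant BEFORE the variable it must not depend on, `∀ η > 0, ∃ q₀`/`∃ T₀` for each
  `o(1)` — and NO rate is invented. "B ∈ ℕ to be chosen … large enough in terms of `ε`" (p. 6) and
  "in terms of `L`" (p. 7, i.e. of the exponent `C_L` in `L ≤ T^{C_L}`) is `∃ B₀, ∀ B ≥ B₀` after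
  `ε, C, C_L`. Where the print leaves a dependence open we type the WEAKER reading (the constant may
  depend on more), never the stronger. Theorem 4's display `J = −(1 + o(1) + O(1/√log 𝓔))·M` is
  typed in its printed RELATIVE form `|J + M| ≤ (η + A/√log 𝓔)|M|` with the presupposition `M ≠ 0`
  (`∫₀¹ C_G(u) sin(πcϑu)/u du ≠ 0`) explicit and the `O`-constant `A` quantified AFTER the fixed data;
  the cell's ADDITIVE form on the natural scale `S(q) = Ŵ_T(0)(φ(q)/q) log L` (binding for
  Propositions 5–6) is proved equivalent to it downstream (`BondarenkoHeap2026Sections3to5`: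
  `theorem4_additive_of_prop5_prop6`, `theorem4_of_prop5_prop6`).
* Script versus italic `I`: the print has the WINDOW integrals `𝓘₁, 𝓘₀` (over `[T^{1−ε}, T^{1+ε}]`,
  p. 5; here `I1`, `I0`) and their extensions `I₁, I₀` to `ℝ` (p. 6; here `I1R`, `I0R`).
  Proposition 1 and Theorems 3–4 are about `I₁, I₀`; equation (8) (`\label{ratio}`, TeX l.407) is
  about `𝓘₁/𝓘₀`, so its deduction uses the extension step of p. 6 (`extensionToLine`).
* The candidate gap constant `c` of `h = 2πc/log T` is a small-gap constant (`c < 1`; `c = 0.473275`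
  in §2.3); Proposition 1's printed error `O₁(ε I₀)` is `O₁(cε I₀)` in general, so `proposition1`
  and `equation8` carry `c ≤ 1` explicitly (a restriction, not a strengthening).
* §2.3: "`f` a smooth function equal to `1` on `[0, L/2]` which decreases smoothly to zero on
  `[L/2, L]` …, `f^{(j)} ≪ L^{−j}`" is typed in the scaling form `f(n) = f₀(n/L)` for a FIXED smooth
  profile `f₀` (`= 1` on `[0, 1/2]`, antitone to `0` on `[1/2, 1]`, `0` after), which has
  `f^{(j)} ≪_j L^{−j}` automatically. -- TODO(general form): an `L`-dependent family with
  `‖f_L^{(j)}‖_∞ ≤ A_j L^{−j}`.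
* "an exceptional character with associated quality `E`" (Definition 1: `χ` primitive quadratic
  mod `q`, `L(1 − 1/(E log q), χ) = 0`, `E ≥ 3`) is the tree's `IsSiegelZero χ E` (same
  normalisation, threshold `10 ≤ E` instead of `3 ≤ E` — Theorem 4 and (8) are used with
  `E → ∞`, so the threshold is immaterial; documented divergence, the typed statements are WEAKER).
* The DAG typed here: `equation8_glue : proposition1 → theorem3 → theorem4 → cPhi_pos →
  weightHat_zero → extensionToLine → equation8` ("Applying these two asymptotics gives (8)") and
  `theorem1_assembly : equation8 → numericalInequality8 → bondarenkoHeap2026_theorem1` (the rest of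
  the "Proof of Theorem 1", via the PROVED small-gaps criterion) — the latter is PROVED at the end of
  this file (`theorem1_assembly_holds`).
* The "computer calculation" behind (8) is the closed-form real inequality `numericalInequality8`
  (no `ζ`, no zeros, no `χ`: an inequality between explicit integrals of polynomials against
  `sin(κu)/u`), typed as a named fact to be discharged by certified numerics (lead's uncertified
  evaluation: main term `≈ 1.0000017`, margin `≈ 1.7·10⁻⁶`).
* NOT here: Propositions 2–3 and Lemma 4 (§§3–4), Propositions 5–6 (§5), §6 — sibling files
  `BondarenkoHeap2026Sections3to5.lean`, `BondarenkoHeap2026Section6.lean`; the complex extension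
  `B_{T,h}(z)` and the polar-term estimates (proof-internal to Proposition 1); no conjecture, no
  route item, no instance, no notation.

## References

* [BondarenkoHeap2026] arXiv:2608.07399v1, §2 (pp. 4–9): (1)–(8), Proposition 1, Theorems 3, 4.
* [BalazardDeRoton2008] Prop. 11 — the Guinand–Weil formula as proved in the tree
  (`tsum_zeros_shift_eq_explicit`), the input of Proposition 1.
* [Titchmarsh1986] §9.1 (the dictionary `γ_n ≤ t ↔ n < N(t)`, tree `Montgomery.zetaOrdinate_le_iff_lt`).
-/

noncomputable section

open Filter MeasureTheory Set
open scoped Real FourierTransform ContDiff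

namespace Literature.NumberTheory.LFunctions

open Literature.Barriers.Parity

namespace BondarenkoHeap2026

/-! ### §2.1 — window count, weights, Dirichlet polynomial, the two integrals -/

/-- `h = 2πc / log T`, the window width attached to the candidate gap constant `c > 0`
("here and throughout", p. 5; TeX l.212). [cite: BondarenkoHeap2026, §2.1 p. 5 (h = 2πc/log T)] -/
def gapWidth (c T : ℝ) : ℝ :=
  2 * π * c / Real.log T

/-- `N_h(t) := N(t + h/2) − N(t − h/2)`, the number of ordinates `γ` of zeros of `ζ` (upper half
plane, with multiplicity; `N` = tree `zetaZeroCount`) with `t − h/2 < γ ≤ t + h/2` (p. 4, TeX l.208: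
"`= Σ_γ 1_{|t−γ| ≤ h/2}`" — the closed window differs from ours only when `γ = t − h/2`, a finite set
of `t`, invisible to the integrals). Real-valued to avoid truncated subtraction; `≥ 0` for
`h ≥ 0` (`windowCount_nonneg`). [cite: BondarenkoHeap2026, §2.1 p. 4 (N_h)] -/
def windowCount (h t : ℝ) : ℝ :=
  (zetaZeroCount (t + h / 2) : ℝ) - (zetaZeroCount (t - h / 2) : ℝ)

/-- The window count over ALL ordinates (both signs), used when the integrals are extended to `ℝ`
"accounting for the symmetry of the zeros" (p. 6): `N_h(t) + N_h(−t)`, i.e. the zeros `ρ` and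
their conjugates `ρ̄` (equal multiplicities, tree `riemannZetaZeroOrder_conj_holds`) within `h/2`
of `t`. [cite: BondarenkoHeap2026, §2.1 p. 6 (extension to ℝ)] -/
def symWindowCount (h t : ℝ) : ℝ :=
  windowCount h t + windowCount h (-t)

/-- The test-function datum of §2.1 (p. 5, TeX l.223–224): "Fix `σ > 0` and a nonzero real even function
`φ ∈ C_c^∞((−σ, σ))`." A hypothesis structure (data + exactly the printed properties); no instance
is asserted. [cite: BondarenkoHeap2026, §2.1 p. 5 (φ and σ)] -/
structure Bump where
  /-- the half-width `σ` of the Fourier support -/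
  σ : ℝ
  /-- the smooth, even, real test function `φ` -/
  φ : ℝ → ℝ
  σ_pos : 0 < σ
  smooth : ContDiff ℝ ∞ φ
  tsupport_subset : tsupport φ ⊆ Set.Ioo (-σ) σ
  even : ∀ ξ : ℝ, φ (-ξ) = φ ξ
  ne_zero : φ ≠ 0

/-- `Φ(x) = ∫ φ(ξ) e^{2πixξ} dξ` for real `x` (p. 5, TeX l.226), i.e. Mathlib's inverse Fourier transform
`𝓕⁻ φ (x)`; we record its real part — `𝓕⁻ φ` is real on `ℝ` because `φ` is real and even
(`Phi_eq`). [cite: BondarenkoHeap2026, §2.1 p. 5 (Φ)] -/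
def Phi (w : Bump) (x : ℝ) : ℝ :=
  (𝓕⁻ (fun ξ : ℝ ↦ (w.φ ξ : ℂ)) x).re

/-- **(1)** `W_T(t) = ((t² + 1/4)/T²)^B {Φ(t/T − 1)² + Φ(t/T + 1)²}` on the real line, `B ∈ ℕ`
"to be chosen" (p. 5; `\label{eq:entire-weight}`, TeX l.229–233, which confirms the reading of the
line-shredded pypdf display; it is also the reading forced by (3), see the module docstring).
[cite: BondarenkoHeap2026, §2.1 (1) p. 5] -/
def weight (w : Bump) (B : ℕ) (T t : ℝ) : ℝ :=
  ((t ^ 2 + 1 / 4) / T ^ 2) ^ B * (Phi w (t / T - 1) ^ 2 + Phi w (t / T + 1) ^ 2)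

/-- `Ŵ_T(ξ) = ∫ W_T(t) e^{−2πitξ} dt` (the paper's Fourier convention is Mathlib's `𝓕`, p. 5, TeX l.220);
real and even because `W_T` is real and even (`weightHat_eq`, `weightHat_even`). [cite: BondarenkoHeap2026, §2.1 (2)–(3) p. 5] -/
def weightHat (w : Bump) (B : ℕ) (T ξ : ℝ) : ℝ :=
  (𝓕 (fun t : ℝ ↦ (weight w B T t : ℂ)) ξ).re

/-- **(3)** `C_Φ = ∫ x^{2B} {Φ(x−1)² + Φ(x+1)²} dx` (p. 5, TeX l.248; it depends on `B` as well).
[cite: BondarenkoHeap2026, §2.1 (3) p. 5] -/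
def cPhi (w : Bump) (B : ℕ) : ℝ :=
  ∫ x : ℝ, x ^ (2 * B) * (Phi w (x - 1) ^ 2 + Phi w (x + 1) ^ 2)

/-- `R(t) = Σ_{n ≤ L} r(n) n^{−1/2−it}` with real coefficients `r(n)` (p. 5, TeX l.255).
[cite: BondarenkoHeap2026, §2.1 p. 5 (R(t))] -/
def dirichletPoly (r : ℕ → ℝ) (L t : ℝ) : ℂ :=
  ∑ n ∈ Finset.Icc 1 ⌊L⌋₊, (r n : ℂ) * (n : ℂ) ^ (-(1 / 2 : ℂ) - t * Complex.I)

/-- `𝓘₁ = ∫_{T^{1−ε}}^{T^{1+ε}} N_h(t) |R(t)|² W_T(t) dt` with `h = 2πc/log T` (p. 5, TeX l.259; script `𝓘`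
in print — the WINDOW integral).
[cite: BondarenkoHeap2026, §2.1 p. 5 (I₁)] -/
def I1 (c ε : ℝ) (w : Bump) (B : ℕ) (r : ℕ → ℝ) (L T : ℝ) : ℝ :=
  ∫ t in Set.Icc (T ^ (1 - ε)) (T ^ (1 + ε)),
    windowCount (gapWidth c T) t * (‖dirichletPoly r L t‖ ^ 2 * weight w B T t)

/-- `𝓘₀ = ∫_{T^{1−ε}}^{T^{1+ε}} |R(t)|² W_T(t) dt` (p. 5, TeX l.260; script `𝓘` in print). [cite: BondarenkoHeap2026, §2.1 p. 5 (I₀)] -/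
def I0 (ε : ℝ) (w : Bump) (B : ℕ) (r : ℕ → ℝ) (L T : ℝ) : ℝ :=
  ∫ t in Set.Icc (T ^ (1 - ε)) (T ^ (1 + ε)), ‖dirichletPoly r L t‖ ^ 2 * weight w B T t

/-- The numerator extended to `ℝ` (p. 6, TeX l.280; italic `I₁` in print): `∫_ℝ N_h(t)|R(t)|² W_T(t) dt`
with the window count over all ordinates (`symWindowCount`). This is the `I₁` of Proposition 1
and of Theorem 4. [cite: BondarenkoHeap2026, §2.1 p. 6 (I₁ over ℝ)] -/
def I1R (c : ℝ) (w : Bump) (B : ℕ) (r : ℕ → ℝ) (L T : ℝ) : ℝ :=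
  ∫ t : ℝ, symWindowCount (gapWidth c T) t * (‖dirichletPoly r L t‖ ^ 2 * weight w B T t)

/-- The denominator extended to `ℝ` (p. 6, TeX l.280; italic `I₀`; the `I₀ = ∫_ℝ |R(t)|² W_T(t) dt` of
Theorem 3).
[cite: BondarenkoHeap2026, §2.1 p. 6 (I₀ over ℝ)] -/
def I0R (w : Bump) (B : ℕ) (r : ℕ → ℝ) (L T : ℝ) : ℝ :=
  ∫ t : ℝ, ‖dirichletPoly r L t‖ ^ 2 * weight w B T t

/-- **(4)** `B_{T,h}(u) = ∫_ℝ 1_{|u−t| < h/2} |R(t)|² W_T(t) dt` (p. 6, `\label{B}`, TeX l.288), so that `I₁ = Σ_γ B_{T,h}(γ)`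
and, "as a convolution", `B̂_{T,h}(ξ) = (sin(πhξ)/(πξ)) Σ_{m,n ≤ L} r(m)r(n)/√(mn) Ŵ_T(ξ + log(m/n)/2π)`
(both identities are used only inside the proof of Proposition 1 and are not typed separately).
[cite: BondarenkoHeap2026, §2.2 (4) p. 6] -/
def bWindow (c : ℝ) (w : Bump) (B : ℕ) (r : ℕ → ℝ) (L T u : ℝ) : ℝ :=
  ∫ t in Set.Ioo (u - gapWidth c T / 2) (u + gapWidth c T / 2), ‖dirichletPoly r L t‖ ^ 2 * weight w B T t

/-! ### §2.1 — proved bookkeeping: `Φ` and `Ŵ_T` are real, `W_T ≥ 0` is even, `N_h ≥ 0` -/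

/-- `φ` has compact support (it is supported in `(−σ, σ)`). [cite: BondarenkoHeap2026, §2.1 p. 5 (φ ∈ C_c^∞)] -/
theorem Bump.hasCompactSupport (w : Bump) : HasCompactSupport w.φ :=
  (isCompact_Icc (a := -w.σ) (b := w.σ)).of_isClosed_subset (isClosed_tsupport _)
    (w.tsupport_subset.trans Set.Ioo_subset_Icc_self)

/-- `φ` (as a complex-valued function) is integrable. [cite: BondarenkoHeap2026, §2.1 p. 5 (φ ∈ C_c^∞)] -/
theorem Bump.integrable (w : Bump) : Integrable fun ξ : ℝ ↦ (w.φ ξ : ℂ) :=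
  ((Complex.continuous_ofReal.comp w.smooth.continuous).integrable_of_hasCompactSupport
    (w.hasCompactSupport.comp_left Complex.ofReal_zero))

/-- For a real even integrand, `𝓕 φ = 𝓕⁻ φ` (substitute `ξ ↦ −ξ`). [folklore] -/
private theorem fourier_eq_fourierInv_of_even {φ : ℝ → ℝ} (hφ : ∀ ξ : ℝ, φ (-ξ) = φ ξ) :
    𝓕 (fun ξ : ℝ ↦ (φ ξ : ℂ)) = 𝓕⁻ (fun ξ : ℝ ↦ (φ ξ : ℂ)) := by
  rw [Real.fourierInv_eq_fourier_comp_neg]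
  simp [hφ]

/-- For a real integrand, `𝓕⁻ φ (x) = conj (𝓕 φ (x))`. [folklore] -/
private theorem fourierInv_eq_conj_fourier (φ : ℝ → ℝ) (x : ℝ) :
    𝓕⁻ (fun ξ : ℝ ↦ (φ ξ : ℂ)) x = (starRingEnd ℂ) (𝓕 (fun ξ : ℝ ↦ (φ ξ : ℂ)) x) := by
  rw [Real.fourierInv_eq', Real.fourier_eq', ← integral_conj]
  refine integral_congr_ae (Eventually.of_forall fun ξ ↦ ?_)
  simp only [smul_eq_mul, map_mul, Complex.conj_ofReal, ← Complex.exp_conj, map_mul,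
    Complex.conj_ofReal, Complex.conj_I]
  congr 1
  push_cast
  ring_nf

/-- `Φ = 𝓕⁻ φ` is real on `ℝ` (because `φ` is real and even): the complex number `𝓕⁻ φ (x)` equals
`Φ(x)`. [cite: BondarenkoHeap2026, §2.1 p. 5 (Φ real)] -/
theorem Phi_eq (w : Bump) (x : ℝ) : (Phi w x : ℂ) = 𝓕⁻ (fun ξ : ℝ ↦ (w.φ ξ : ℂ)) x := by
  have h1 := fourierInv_eq_conj_fourier w.φ x
  rw [fourier_eq_fourierInv_of_even w.even] at h1
  -- `z = conj z` forces `z` real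
  rw [Phi]
  exact Complex.conj_eq_iff_re.mp h1.symm

/-- `Φ` is even (`φ` is even). [cite: BondarenkoHeap2026, §2.1 p. 5 (Φ even)] -/
theorem Phi_neg (w : Bump) (x : ℝ) : Phi w (-x) = Phi w x := by
  simp only [Phi]
  rw [Real.fourierInv_eq_fourier_neg, neg_neg, fourier_eq_fourierInv_of_even w.even]

/-- `Φ` is continuous. [cite: BondarenkoHeap2026, §2.1 p. 5 (Φ)] -/
theorem continuous_Phi (w : Bump) : Continuous (Phi w) := by
  have h : Continuous (𝓕⁻ (fun ξ : ℝ ↦ (w.φ ξ : ℂ))) := by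
    rw [Real.fourierInv_eq_fourier_comp_neg]
    exact VectorFourier.fourierIntegral_continuous Real.continuous_fourierChar continuous_inner
      w.integrable.comp_neg
  exact Complex.continuous_re.comp h

/-- **`W_T(t) ≥ 0` for real `t`** (p. 5). [cite: BondarenkoHeap2026, §2.1 (1) p. 5 (W_T ≥ 0)] -/
theorem weight_nonneg (w : Bump) (B : ℕ) (T t : ℝ) : 0 ≤ weight w B T t :=
  mul_nonneg (pow_nonneg (div_nonneg (by positivity) (sq_nonneg T)) B) (by positivity)

/-- **`W_T` is even** (p. 5). [cite: BondarenkoHeap2026, §2.1 (1) p. 5 (W_T even)] -/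
theorem weight_even (w : Bump) (B : ℕ) (T t : ℝ) : weight w B T (-t) = weight w B T t := by
  have h1 : Phi w (-t / T - 1) = Phi w (t / T + 1) := by
    rw [← Phi_neg w (t / T + 1)]; congr 1; ring
  have h2 : Phi w (-t / T + 1) = Phi w (t / T - 1) := by
    rw [← Phi_neg w (t / T - 1)]; congr 1; ring
  rw [weight, weight, h1, h2, neg_sq, add_comm (Phi w (t / T + 1) ^ 2)]

/-- `W_T` is continuous on `ℝ`. [cite: BondarenkoHeap2026, §2.1 (1) p. 5] -/
theorem continuous_weight (w : Bump) (B : ℕ) (T : ℝ) : Continuous fun t : ℝ ↦ weight w B T t := by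
  have hΦ := continuous_Phi w
  unfold weight
  exact ((continuous_pow B).comp ((continuous_pow 2 |>.add continuous_const).div_const _)).mul
    (((hΦ.comp ((continuous_id.div_const T).sub continuous_const)).pow 2).add
      ((hΦ.comp ((continuous_id.div_const T).add continuous_const)).pow 2))

/-- `Ŵ_T(ξ)` is real: the complex number `𝓕 W_T (ξ)` equals `Ŵ_T(ξ)` (`W_T` is real and even).
[cite: BondarenkoHeap2026, §2.1 (2)–(3) p. 5] -/
theorem weightHat_eq (w : Bump) (B : ℕ) (T ξ : ℝ) :
    (weightHat w B T ξ : ℂ) = 𝓕 (fun t : ℝ ↦ (weight w B T t : ℂ)) ξ := by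
  have h1 := fourierInv_eq_conj_fourier (fun t : ℝ ↦ weight w B T t) ξ
  rw [← fourier_eq_fourierInv_of_even (weight_even w B T)] at h1
  rw [weightHat]
  exact Complex.conj_eq_iff_re.mp h1.symm

/-- `Ŵ_T` is even: `Ŵ_T(−ξ) = Ŵ_T(ξ)` (`W_T` is real and even; reconciles the arguments
`log(km/n)/2π` of Theorem 4, TeX l.387, and `log(n/km)/2π` of §5, TeX l.621).
[cite: BondarenkoHeap2026, §2.1 (2)–(3) p. 5] -/
theorem weightHat_even (w : Bump) (B : ℕ) (T ξ : ℝ) : weightHat w B T (-ξ) = weightHat w B T ξ := by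
  simp only [weightHat]
  rw [← Real.fourierInv_eq_fourier_neg, ← fourier_eq_fourierInv_of_even (weight_even w B T)]

/-- The Dirichlet polynomial `R` is continuous in `t`. [cite: BondarenkoHeap2026, §2.1 p. 5 (R(t))] -/
theorem continuous_dirichletPoly (r : ℕ → ℝ) (L : ℝ) : Continuous (dirichletPoly r L) := by
  unfold dirichletPoly
  refine continuous_finsetSum _ fun n hn ↦ continuous_const.mul ?_
  have hn0 : (n : ℂ) ≠ 0 := by
    have : 1 ≤ n := (Finset.mem_Icc.mp hn).1
    exact_mod_cast (by omega : n ≠ 0)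
  exact Continuous.const_cpow (by fun_prop) (Or.inl hn0)

/-- `N_h(t) ≥ 0` for `h ≥ 0` (monotonicity of `N`, tree `zetaZeroCount_mono`).
[cite: BondarenkoHeap2026, §2.1 p. 4 (N_h)] -/
theorem windowCount_nonneg {h : ℝ} (hh : 0 ≤ h) (t : ℝ) : 0 ≤ windowCount h t := by
  have hmono : zetaZeroCount (t - h / 2) ≤ zetaZeroCount (t + h / 2) := zetaZeroCount_mono (by linarith)
  unfold windowCount
  exact sub_nonneg.mpr (by exact_mod_cast hmono)

/-- `h = 2πc/log T ≥ 0` for `c ≥ 0` and `T ≥ 1`. [cite: BondarenkoHeap2026, §2.1 p. 5 (h)] -/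
theorem gapWidth_nonneg {c T : ℝ} (hc : 0 ≤ c) (hT : 1 ≤ T) : 0 ≤ gapWidth c T :=
  div_nonneg (by positivity) (Real.log_nonneg hT)

/-- `𝓘₀ ≥ 0` (non-negative integrand). [cite: BondarenkoHeap2026, §2.1 p. 5 (I₀)] -/
theorem I0_nonneg (ε : ℝ) (w : Bump) (B : ℕ) (r : ℕ → ℝ) (L T : ℝ) : 0 ≤ I0 ε w B r L T :=
  setIntegral_nonneg measurableSet_Icc fun t _ ↦ mul_nonneg (sq_nonneg _) (weight_nonneg w B T t)

/-! ### §2.1 — the small-gaps criterion (PROVED) -/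

/-- **Small gaps criterion, measure-theoretic half** (p. 5, bullet, TeX l.265): "If `𝓘₁ > 𝓘₀` there exists a
`t ∈ [T^{1−ε}, T^{1+ε}]` for which `N_h(t) > 1`." (If `N_h ≤ 1` on the window then, `W_T |R|²`
being non-negative and continuous, `I₁ ≤ I₀`.) [cite: BondarenkoHeap2026, §2.1 p. 5 (small gaps criterion)] -/
theorem exists_one_lt_windowCount_of_I0_lt_I1 {c ε : ℝ} {w : Bump} {B : ℕ} {r : ℕ → ℝ} {L T : ℝ}
    (hc : 0 ≤ c) (hT : 1 ≤ T) (h : I0 ε w B r L T < I1 c ε w B r L T) :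
    ∃ t ∈ Set.Icc (T ^ (1 - ε)) (T ^ (1 + ε)), 1 < windowCount (gapWidth c T) t := by
  by_contra hcon
  push Not at hcon
  set g : ℝ → ℝ := fun t ↦ ‖dirichletPoly r L t‖ ^ 2 * weight w B T t with hg
  have hg_cont : Continuous g :=
    ((continuous_norm.comp (continuous_dirichletPoly r L)).pow 2).mul (continuous_weight w B T)
  have hg_nn : ∀ t, 0 ≤ g t := fun t ↦ mul_nonneg (sq_nonneg _) (weight_nonneg w B T t)
  have hh : 0 ≤ gapWidth c T := gapWidth_nonneg hc hT
  have hle : I1 c ε w B r L T ≤ I0 ε w B r L T := by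
    unfold I1 I0
    refine integral_mono_of_nonneg ?_ hg_cont.integrableOn_Icc ?_
    · exact Eventually.of_forall fun t ↦ mul_nonneg (windowCount_nonneg hh t) (hg_nn t)
    · rw [EventuallyLE, ae_restrict_iff' measurableSet_Icc]
      refine Eventually.of_forall fun t ht ↦ ?_
      have h1 := hcon t ht
      have h2 := hg_nn t
      show windowCount (gapWidth c T) t * g t ≤ g t
      nlinarith
  exact absurd h (not_lt.mpr hle)

/-- **Small gaps criterion, counting half**: `N_h(t) > 1`, i.e. `N(t + h/2) ≥ N(t − h/2) + 2`, gives
two consecutive ordinates in the window, `t − h/2 < γ_m ≤ γ_{m+1} ≤ t + h/2` with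
`m = N(t − h/2)` (tree dictionary `γ_n ≤ t ↔ n < N(t)`, `Montgomery.zetaOrdinate_le_iff_lt`).
[cite: BondarenkoHeap2026, §2.1 p. 5 (small gaps criterion)] -/
theorem exists_close_pair_of_one_lt_windowCount {h t : ℝ} (h1 : 1 < windowCount h t) :
    ∃ m : ℕ, t - h / 2 < zetaOrdinate m ∧ zetaOrdinate (m + 1) ≤ t + h / 2 ∧
      zetaOrdinate m ≤ zetaOrdinate (m + 1) := by
  set m := zetaZeroCount (t - h / 2) with hm
  have h2 : m + 1 < zetaZeroCount (t + h / 2) := by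
    unfold windowCount at h1
    have : (m : ℝ) + 1 < zetaZeroCount (t + h / 2) := by rw [hm]; linarith
    exact_mod_cast this
  exact ⟨m, Montgomery.lt_zetaOrdinate_iff.mpr le_rfl, Montgomery.zetaOrdinate_le_iff_lt.mpr h2,
    zetaOrdinate_mono_holds (Nat.le_succ m)⟩

/-- The normalised size of a gap of length `≤ h = 2πc/log T` at an ordinate `γ_m ≤ b`:
`δ_m = (γ_{m+1} − γ_m) log γ_m/(2π) ≤ c · log b / log T` (for `c ≥ 0`, `T > 1`).
[cite: BondarenkoHeap2026, §2.1 p. 5 (small gaps criterion)] -/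
theorem zetaNormalizedGap_le_of_gap_le {c T b : ℝ} {m : ℕ} (hc : 0 ≤ c) (hT : 1 < T)
    (hgap : zetaOrdinate (m + 1) - zetaOrdinate m ≤ gapWidth c T) (hb : zetaOrdinate m ≤ b) :
    zetaNormalizedGap m ≤ c * Real.log b / Real.log T := by
  have hlogT : 0 < Real.log T := Real.log_pos hT
  -- every ordinate is `> 14 ≥ 1` (tree `fourteen_lt_zetaOrdinate_zero_holds`, `zetaOrdinate_mono_holds`;
  -- cf. `RudnickSarnakN.Unsmooth.one_le_zetaOrdinate`)
  have hγ1 : 1 ≤ zetaOrdinate m := by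
    have h14 : (14 : ℝ) < zetaOrdinate 0 := fourteen_lt_zetaOrdinate_zero_holds
    linarith [zetaOrdinate_mono_holds (Nat.zero_le m)]
  have hlogγ : 0 ≤ Real.log (zetaOrdinate m) := Real.log_nonneg hγ1
  have hlogb : Real.log (zetaOrdinate m) ≤ Real.log b := Real.log_le_log (by linarith) hb
  rw [zetaNormalizedGap_eq_mul_div]
  calc (zetaOrdinate (m + 1) - zetaOrdinate m) * Real.log (zetaOrdinate m) / (2 * π)
      ≤ gapWidth c T * Real.log (zetaOrdinate m) / (2 * π) := by gcongr
    _ = c * Real.log (zetaOrdinate m) / Real.log T := by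
        rw [gapWidth]; field_simp
    _ ≤ c * Real.log b / Real.log T := by gcongr

/-- **Small gaps criterion** (p. 5, TeX l.265), both halves: if `𝓘₁ > 𝓘₀` (with `c ≥ 0`, `T > 1`) then there are
consecutive ordinates `T^{1−ε} − h/2 < γ_m ≤ γ_{m+1} ≤ T^{1+ε} + h/2` with `γ_{m+1} − γ_m ≤ h`,
"giving a small gap of normalised size `≤ c(1 + ε)`" — precisely
`δ_m ≤ c · log(T^{1+ε} + h/2)/log T`. [cite: BondarenkoHeap2026, §2.1 p. 5 (small gaps criterion)] -/
theorem smallGaps_criterion {c ε : ℝ} {w : Bump} {B : ℕ} {r : ℕ → ℝ} {L T : ℝ}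
    (hc : 0 ≤ c) (hT : 1 < T) (h : I0 ε w B r L T < I1 c ε w B r L T) :
    ∃ m : ℕ, T ^ (1 - ε) - gapWidth c T / 2 < zetaOrdinate m ∧
      zetaOrdinate (m + 1) ≤ T ^ (1 + ε) + gapWidth c T / 2 ∧
      zetaOrdinate (m + 1) - zetaOrdinate m ≤ gapWidth c T ∧
      zetaNormalizedGap m ≤ c * Real.log (T ^ (1 + ε) + gapWidth c T / 2) / Real.log T := by
  obtain ⟨t, ht, h1⟩ := exists_one_lt_windowCount_of_I0_lt_I1 hc hT.le h
  obtain ⟨m, hlow, hup, hmono⟩ := exists_close_pair_of_one_lt_windowCount h1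
  have hgap : zetaOrdinate (m + 1) - zetaOrdinate m ≤ gapWidth c T := by linarith
  refine ⟨m, by linarith [ht.1], by linarith [ht.2], hgap, ?_⟩
  exact zetaNormalizedGap_le_of_gap_le hc hT hgap (by linarith [ht.2])

/-! ### §2.1 — named facts (2), (3) and the extension to `ℝ` -/

/-- **(2)** "`supp Ŵ_T ⊆ [−2σ/T, 2σ/T]`" (p. 5, `\label{eq:weight-support}`, TeX l.235–239): the Fourier
transform of `W_T` vanishes off that
interval (for `T > 0`). A fact of calculus (Paley–Wiener for `Φ² = (𝓕⁻φ)²`, `supp φ ⊆ (−σ, σ)`,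
times a polynomial, rescaled), NOT proved here. [claim: BondarenkoHeap2026, status: under-review] -/
def weightHat_support : Prop :=
  ∀ (w : Bump) (B : ℕ) (T : ℝ), 0 < T → ∀ ξ : ℝ, 2 * w.σ / T < |ξ| →
    𝓕 (fun t : ℝ ↦ (weight w B T t : ℂ)) ξ = 0

/-- **(3)** "`Ŵ_T(0) = C_Φ T + O_{Φ,B}(T^{−1})`" (p. 5, `\label{eq:weight-mass}`, TeX l.241–244): for
every datum there is `K` with
`|Ŵ_T(0) − C_Φ T| ≤ K/T` for all `T ≥ 1`. NOT proved here. [claim: BondarenkoHeap2026, status: under-review] -/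
def weightHat_zero : Prop :=
  ∀ (w : Bump) (B : ℕ), ∃ K : ℝ, ∀ T : ℝ, 1 ≤ T → |weightHat w B T 0 - cPhi w B * T| ≤ K * T⁻¹

/-- **(3), positivity** "`C_Φ = ∫ x^{2B} {Φ(x−1)² + Φ(x+1)²} dx > 0`" (p. 5, TeX l.247–250; `φ ≠ 0`, so the entire
function `Φ` is not identically zero). NOT proved here. [claim: BondarenkoHeap2026, status: under-review] -/
def cPhi_pos : Prop :=
  ∀ (w : Bump) (B : ℕ), 0 < cPhi w B

/-- **Extension of the integrals to `ℝ`** (p. 6, TeX l.269–281): "From the rapid decay of `Φ` and the trivial bounds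
`R(t)² ≪ L^{1+ε}`, `N_h(t) ≪ log(2+|t|)` the tail `|t| > T^{1+ε}` is `≪ T^{ε(2B−A)} L^{1+ε′}` for any
given `A > 0`. Choosing `A` sufficiently large in terms of `B`, `ε` and `L` then gives `O(T^{−C})`. For
the region `|t| < T^{1−ε}`, the pre-factor `((t²+1/4)/T²)^B` in `W_T` gives the necessary decay on
choosing `B` large enough in terms of `ε`. Then, accounting for the symmetry of the zeros,
`𝓘₁/𝓘₀ = I₁/I₀ + O(T^{−C})` … Here we have assumed `I₀ ≫ 1`." Typed: for `c > 0`, `0 < ε < 1`,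
`C > 0`, `C_L > 0` (`L ≤ T^{C_L}`), `A ≥ 0` (`|r(n)| ≤ A n^ε`) and a bump, there is `B₀` such that
for every `B ≥ B₀` there are `K, T₀` with: for `T ≥ T₀`, `1 ≤ L ≤ T^{C_L}`, such `r`, and `I₀ ≥ 1`
(the `ℝ`-integral), the window integral `𝓘₀` is positive and `|𝓘₁/𝓘₀ − I₁/I₀| ≤ K T^{−C}`.
Unconditional (no RH). NOT proved here. [claim: BondarenkoHeap2026, status: under-review] -/
def extensionToLine : Prop :=
  ∀ (c ε C CL A : ℝ), 0 < c → 0 < ε → ε < 1 → 0 < C → 0 < CL → 0 ≤ A →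
  ∀ (w : Bump), ∃ B₀ : ℕ, ∀ B : ℕ, B₀ ≤ B → ∃ K T₀ : ℝ, ∀ T : ℝ, T₀ ≤ T →
  ∀ (L : ℝ), 1 ≤ L → L ≤ T ^ CL → ∀ (r : ℕ → ℝ), (∀ n : ℕ, 1 ≤ n → |r n| ≤ A * (n : ℝ) ^ ε) →
    1 ≤ I0R w B r L T →
      0 < I0 ε w B r L T ∧
        |I1 c ε w B r L T / I0 ε w B r L T - I1R c w B r L T / I0R w B r L T| ≤ K * T ^ (-C)

/-! ### §2.2 — Proposition 1 (explicit formula, on RH) -/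

/-- `g_h(k) = sin(½ h log k)/log k` (Proposition 1, p. 7, TeX l.338). [cite: BondarenkoHeap2026, Proposition 1 p. 7 (g_h)] -/
def gWeight (h : ℝ) (k : ℕ) : ℝ :=
  Real.sin (h * Real.log k / 2) / Real.log k

/-- The prime-side sum of Proposition 1 (p. 7, TeX l.332–335):
`S = Σ_{m,n ≤ L; k ≥ 2} Λ(k) g_h(k) r(m) r(n)/√(kmn) · Ŵ_T(log(km/n)/2π)` with `h = 2πc/log T`
(`Λ(0) = Λ(1) = 0`, so the `k`-sum may run over all `k`; it is a finite sum by (2), written as a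
`tsum`). With `r = χ·G` it is the `J` of Theorem 4. [cite: BondarenkoHeap2026, Proposition 1 p. 7] -/
def primeSum (c : ℝ) (w : Bump) (B : ℕ) (r : ℕ → ℝ) (L T : ℝ) : ℝ :=
  ∑ m ∈ Finset.Icc 1 ⌊L⌋₊, ∑ n ∈ Finset.Icc 1 ⌊L⌋₊, ∑' k : ℕ,
    ArithmeticFunction.vonMangoldt k * gWeight (gapWidth c T) k * r m * r n /
        Real.sqrt ((k : ℝ) * m * n) *
      weightHat w B T (Real.log ((k : ℝ) * m / n) / (2 * π))

/-- **Proposition 1** (p. 7, TeX l.330–340): "Assume RH. Then for any fixed `ε > 0` we have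
`I₁ = c I₀ − (2/π) Σ_{m,n ≤ L; k ≥ 2} Λ(k) g_h(k) r(m) r(n)/√(kmn) · Ŵ_T(log(km/n)/2π) + O₁(ε I₀)
+ o(I₀) + O_ε(T^{−C})`, where `g_h(k) = sin(½ h log k)/log k`" (`O₁` = implied constant of absolute
value `≤ 1`; `I₁, I₀` the integrals over `ℝ`; standing hypotheses of §2.1: real `r(n) ≪ n^ε`,
`L ≤ T^C`, `B` large in terms of `ε` and of `L`). Typed with the quantifiers explicit and in the
printed order of dependence (`B₀` after `ε, C, C_L`; the `O_ε`-constant `K` after `B`; `o(1)` as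
`∀ η > 0, ∃ T₀`), with `0 < c ≤ 1` (for `c > 1` the printed `O₁(ε I₀)` reads `O₁(cε I₀)`) and
Mathlib's `RiemannHypothesis` as the explicit antecedent. CLAIM of an unrefereed source, NOT proved
here (its proof is the tree's Guinand–Weil formula `tsum_zeros_shift_eq_explicit` applied to
`B_{T,h}`). [claim: BondarenkoHeap2026, status: under-review] -/
def proposition1 : Prop :=
  RiemannHypothesis →
  ∀ (c ε C CL A : ℝ), 0 < c → c ≤ 1 → 0 < ε → ε < 1 → 0 < C → 0 < CL → 0 ≤ A →
  ∀ (w : Bump), ∃ B₀ : ℕ, ∀ B : ℕ, B₀ ≤ B → ∃ K : ℝ, ∀ η : ℝ, 0 < η → ∃ T₀ : ℝ, ∀ T : ℝ, T₀ ≤ T →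
  ∀ (L : ℝ), 1 ≤ L → L ≤ T ^ CL → ∀ (r : ℕ → ℝ), (∀ n : ℕ, 1 ≤ n → |r n| ≤ A * (n : ℝ) ^ ε) →
    |I1R c w B r L T - (c * I0R w B r L T - 2 / π * primeSum c w B r L T)|
      ≤ ε * I0R w B r L T + η * I0R w B r L T + K * T ^ (-C)

/-! ### §2.3 — the resonator, parameters (5), Theorems 3 and 4 -/

/-- The resonator datum of §2.3 (pp. 7–8, TeX l.347–363): "Fix `0 < δ < 10^{−2}`"; "`G₀` a polynomial and `f` a
smooth function equal to `1` on `[0, L/2]` which decreases smoothly to zero on `[L/2, L]` whereafter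
it remains zero", typed in the scaling form `f(n) = f₀(n/L)` (module docstring). A hypothesis
structure; no instance asserted. [cite: BondarenkoHeap2026, §2.3 pp. 7–8 (resonator) and (5)] -/
structure Resonator where
  /-- the exponent excess `δ` in `T = q^{7/3+δ}` -/
  δ : ℝ
  /-- the polynomial profile `G₀` -/
  G₀ : Polynomial ℝ
  /-- the smooth cut-off profile `f₀` (`f(n) = f₀(n/L)`) -/
  f₀ : ℝ → ℝ
  δ_pos : 0 < δ
  δ_lt : δ < 1 / 100
  f₀_smooth : ContDiff ℝ ∞ f₀
  f₀_eq_one : ∀ x ∈ Set.Icc (0 : ℝ) (1 / 2), f₀ x = 1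
  f₀_antitoneOn : AntitoneOn f₀ (Set.Icc (1 / 2 : ℝ) 1)
  f₀_eq_zero : ∀ x : ℝ, 1 ≤ x → f₀ x = 0

/-- **(5)** `T = q^{7/3+δ}` (p. 8, `\label{eq:parameters}`, TeX l.357–363). [cite: BondarenkoHeap2026, §2.3 (5) p. 8] -/
def Resonator.T (ρ : Resonator) (q : ℕ) : ℝ :=
  (q : ℝ) ^ (7 / 3 + ρ.δ)

/-- **(5)** `L = T q^{1/2−δ} = q^{17/6}` (p. 8; independent of `δ`). [cite: BondarenkoHeap2026, §2.3 (5) p. 8] -/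
def lengthL (q : ℕ) : ℝ :=
  (q : ℝ) ^ (17 / 6 : ℝ)

/-- **(5)** `ϑ = ϑ_δ = log L/log T = 17/(14 + 6δ)` (p. 8; the closed form, see `theta_eq`).
[cite: BondarenkoHeap2026, §2.3 (5) p. 8] -/
def theta (δ : ℝ) : ℝ :=
  17 / (14 + 6 * δ)

/-- `G(n) = G₀(log n/log L) f(n)` with `f(n) = f₀(n/L)` (p. 8). [cite: BondarenkoHeap2026, §2.3 p. 8 (G(n))] -/
def Resonator.G (ρ : Resonator) (q n : ℕ) : ℝ :=
  ρ.G₀.eval (Real.log n / Real.log (lengthL q)) * ρ.f₀ (n / lengthL q)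

/-- The resonator coefficients `r(n) = χ(n) G(n)` (p. 7), `χ` a quadratic character (real values,
`re_quadratic`), so `R(t) = Σ_{n ≤ L} χ(n)G(n) n^{−1/2−it}`. [cite: BondarenkoHeap2026, §2.3 p. 7 (R(t) = Σ χ(n)G(n)n^{-1/2-it})] -/
def Resonator.coeff (ρ : Resonator) {q : ℕ} (χ : DirichletCharacter ℂ q) (n : ℕ) : ℝ :=
  (χ (n : ZMod q)).re * ρ.G q n

/-- **(7)** `D_G = ∫₀¹ G₀(x)² dx` (p. 8, `\label{eq:DG}`, TeX l.379–381). [cite: BondarenkoHeap2026, Theorem 3 (7) p. 8] -/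
def dG (G₀ : Polynomial ℝ) : ℝ :=
  ∫ x in (0 : ℝ)..1, (G₀.eval x) ^ 2

/-- `C_G(u) = ∫₀^{1−u} G₀(x) G₀(x + u) dx` (Theorem 4, p. 8). [cite: BondarenkoHeap2026, Theorem 4 p. 8 (C_G)] -/
def cG (G₀ : Polynomial ℝ) (u : ℝ) : ℝ :=
  ∫ x in (0 : ℝ)..(1 - u), G₀.eval x * G₀.eval (x + u)

/-- The main term of Theorem 3: `D_G Ŵ_T(0) (φ(q)/q) log L` (`= D_G · S(q)` with the natural scale
`S(q) = Ŵ_T(0)(φ(q)/q) log L`, the sibling file's `scaleS`). [cite: BondarenkoHeap2026, Theorem 3 (6) p. 8] -/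
def I0main (w : Bump) (B : ℕ) (ρ : Resonator) (q : ℕ) : ℝ :=
  dG ρ.G₀ * weightHat w B (ρ.T q) 0 * ((Nat.totient q : ℝ) / q) * Real.log (lengthL q)

/-- **Theorem 3** (p. 8, TeX l.367–383, `\label{denom thm}`): "Let `I₀ = ∫_ℝ |R(t)|² W_T(t) dt` with the above choices of `T`, `L` and
`R(t)`. Then (6) `I₀ = (1 + o(1)) D_G Ŵ_T(0) (φ(q)/q) log L` where (7) `D_G = ∫₀¹ G₀(x)² dx`."
(`q → ∞` through moduli of primitive quadratic characters, the bump, `B` and the resonator datum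
fixed; `o(1)` typed as `∀ η > 0, ∃ q₀`.) Unconditional. CLAIM of an unrefereed source, NOT proved
here (its proof is §4). [claim: BondarenkoHeap2026, status: under-review] -/
def theorem3 : Prop :=
  ∀ (w : Bump) (B : ℕ) (ρ : Resonator) (η : ℝ), 0 < η → ∃ q₀ : ℕ,
    ∀ (q : ℕ) [NeZero q] (χ : DirichletCharacter ℂ q), q₀ ≤ q → χ.IsPrimitive → χ.IsQuadratic →
      |I0R w B (ρ.coeff χ) (lengthL q) (ρ.T q) - I0main w B ρ q| ≤ η * I0main w B ρ q

/-- `J = Σ_{m,n ≤ L; k ≥ 2} Λ(k) g_h(k) χ(m)χ(n) G(m)G(n)/√(kmn) · Ŵ_T(log(km/n)/2π)` (Theorem 4, p. 8):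
the prime sum of Proposition 1 for `r = χ·G`, so that (by Proposition 1)
`I₁ = cI₀ − (2/π)J + O₁(εI₀) + o(I₀)`. [cite: BondarenkoHeap2026, Theorem 4 p. 8 (J)] -/
def J (c : ℝ) (w : Bump) (B : ℕ) (ρ : Resonator) {q : ℕ} (χ : DirichletCharacter ℂ q) : ℝ :=
  primeSum c w B (ρ.coeff χ) (lengthL q) (ρ.T q)

/-- The oscillatory integral `∫₀¹ C_G(u) sin(πcϑu)/u du` of Theorem 4 and (8).
[cite: BondarenkoHeap2026, Theorem 4 p. 8 and (8) p. 9] -/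
def sineIntegralCG (δ c : ℝ) (G₀ : Polynomial ℝ) : ℝ :=
  ∫ u in (0 : ℝ)..1, cG G₀ u * Real.sin (π * c * theta δ * u) / u

/-- The main term of Theorem 4: `Ŵ_T(0) (φ(q)/q) log L ∫₀¹ C_G(u) sin(πcϑu)/u du` (with
`ϑ = log L/log T = ϑ_δ`, (5); `= S(q) · ∫…`). [cite: BondarenkoHeap2026, Theorem 4 p. 8] -/
def Jmain (c : ℝ) (w : Bump) (B : ℕ) (ρ : Resonator) (q : ℕ) : ℝ :=
  weightHat w B (ρ.T q) 0 * ((Nat.totient q : ℝ) / q) * Real.log (lengthL q) * sineIntegralCG ρ.δ c ρ.G₀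

/-- **Theorem 4** (p. 8, TeX l.385–403, `\label{num thm}`):
"Let `J = Σ_{m,n ≤ L; k ≥ 2} Λ(k) g_h(k) χ(m)χ(n)G(m)G(n)/√(kmn) Ŵ_T(log(km/n)/2π)`
so that `I₁ = cI₀ − (2/π)J + O₁(εI₀) + o(I₀)`. Suppose that `χ` is an exceptional character with
associated quality `E`. Then `J = −(1 + o(1) + O(1/√log E)) Ŵ_T(0) (φ(q)/q) log L ∫₀¹ C_G(u) sin(πcϑu)/u du`
where `C_G(u) = ∫₀^{1−u} G₀(x)G₀(x+u) dx` and `ϑ = log L/log T`." (The factor `(φ(q)/q)·log L` is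
confirmed by the TeX source, l.393.) Typed: for `c > 0`, a bump, `B`, a resonator datum there is
`A ≥ 0` (the `O`-constant, allowed to depend on all fixed data) such that for every `η > 0` and all
large `q`, every Siegel zero `(χ mod q, E)` in the tree's sense (`IsSiegelZero`: primitive quadratic,
`L(1 − 1/(E log q), χ) = 0`, `E ≥ 10`) has `|J + M| ≤ (η + A/√log E)|M|`, `M` the displayed main term.
The printed RELATIVE form presupposes `M ≠ 0`, i.e. `∫₀¹ C_G(u) sin(πcϑu)/u du ≠ 0` (true for the data
of the proof of Theorem 1, where this integral is `≈ 0.76`); that presupposition is an explicit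
hypothesis here. The cell's ADDITIVE form on the natural scale `S(q) = Ŵ_T(0)(φ(q)/q) log L`,
`|J + M| ≤ (η + A/√log E)·S(q)` (non-degenerate when the integral vanishes), is PROVED from
Propositions 5–6 in the sibling file `BondarenkoHeap2026Sections3to5` (`theorem4_additive_of_prop5_prop6`),
which also derives the present form (`theorem4_of_prop5_prop6`). No RH. CLAIM of an unrefereed
source, NOT proved here (its proof is §§5–6: Propositions 5 and 6). [claim: BondarenkoHeap2026, status: under-review] -/
def theorem4 : Prop :=
  ∀ (c : ℝ), 0 < c → ∀ (w : Bump) (B : ℕ) (ρ : Resonator), sineIntegralCG ρ.δ c ρ.G₀ ≠ 0 →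
    ∃ A : ℝ, 0 ≤ A ∧ ∀ η : ℝ, 0 < η →
    ∃ q₀ : ℕ, ∀ (q : ℕ) [NeZero q] (χ : DirichletCharacter ℂ q) (E : ℝ), q₀ ≤ q → IsSiegelZero χ E →
      |J c w B ρ χ + Jmain c w B ρ q| ≤ (η + A / Real.sqrt (Real.log E)) * |Jmain c w B ρ q|

/-! ### §2.3 — equation (8), the numerical input, and the assembly of Theorem 1 -/

/-- The main term of (8): `c + (2/(π D_G)) ∫₀¹ C_G(u) sin(πcϑ_δ u)/u du` (p. 9, TeX l.407).
[cite: BondarenkoHeap2026, (8) p. 9] -/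
def mainTerm8 (δ c : ℝ) (G₀ : Polynomial ℝ) : ℝ :=
  c + 2 / (π * dG G₀) * sineIntegralCG δ c G₀

/-- **Equation (8)** (p. 9, `\label{ratio}`, TeX l.405–408, "Proof of Theorem 1. Applying these two
asymptotics gives"): `𝓘₁/𝓘₀ = c + (2/(πD_G)) ∫₀¹ C_G(u) sin(πcϑu)/u du + O(ε) + O(1/√log 𝓔) + o(1)`
(on RH, for the resonator of an exceptional character of quality `𝓔`; `𝓘₁, 𝓘₀` the WINDOW integrals
`I1`, `I0` — script `𝓘` in the TeX source). Typed with the constants explicit and in the order of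
dependence that makes each `O` meaningful: the `O(ε)`-constant `K` BEFORE `ε`; then `B ≥ B₀(ε)`;
then the `O(1/√log 𝓔)`-constant `A`; then `∀ η > 0, ∃ q₀` (`o(1)`), then `𝓔`; with `G₀ ≠ 0` (the
display divides by `D_G`), the non-degeneracy `∫₀¹ C_G(u) sin(πcϑu)/u du ≠ 0` under which Theorem 4's
relative form is typed (it holds for the data of the proof of Theorem 1, where it follows from the
numerical inequality, see `theorem1_assembly_holds`), and `0 < c ≤ 1`. A consequence of
Proposition 1, Theorems 3–4 and the extension step of p. 6 (`equation8_glue`); CLAIM, NOT proved here.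
[claim: BondarenkoHeap2026, status: under-review] -/
def equation8 : Prop :=
  RiemannHypothesis →
  ∀ (c : ℝ), 0 < c → c ≤ 1 → ∀ (w : Bump) (ρ : Resonator), ρ.G₀ ≠ 0 →
    sineIntegralCG ρ.δ c ρ.G₀ ≠ 0 →
    ∃ K : ℝ, 0 ≤ K ∧ ∀ ε : ℝ, 0 < ε → ε < 1 → ∃ B₀ : ℕ, ∀ B : ℕ, B₀ ≤ B →
      ∃ A : ℝ, 0 ≤ A ∧ ∀ η : ℝ, 0 < η → ∃ q₀ : ℕ,
        ∀ (q : ℕ) [NeZero q] (χ : DirichletCharacter ℂ q) (E : ℝ), q₀ ≤ q → IsSiegelZero χ E →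
          |I1 c ε w B (ρ.coeff χ) (lengthL q) (ρ.T q) / I0 ε w B (ρ.coeff χ) (lengthL q) (ρ.T q)
              - mainTerm8 ρ.δ c ρ.G₀|
            ≤ K * ε + A / Real.sqrt (Real.log E) + η

/-- The fixed polynomial of the proof of Theorem 1 (p. 9, TeX l.420): `G₀(x) = 1 − (63/125)(x − 1/2)²`
("which is positive on `[0,1]`"). [cite: BondarenkoHeap2026, proof of Theorem 1 p. 9] -/
def G₀star : Polynomial ℝ :=
  1 - Polynomial.C (63 / 125 : ℝ) * (Polynomial.X - Polynomial.C (1 / 2 : ℝ)) ^ 2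

/-- **The numerical input of the proof of Theorem 1** (p. 9, TeX l.411–422): "We now fix `δ = 10^{−6}`,
`ϑ = 17/(14 + 6δ)`, `c = 0.473275`, and choose `G₀(x) = 1 − (63/125)(x − 1/2)²` … A computer
calculation then shows that the right hand side of (8) is `> 1` for `ε` sufficiently small and `E`
sufficiently large", i.e. the MAIN TERM of (8) exceeds `1`:
`1 < 0.473275 + (2/(π D_G)) ∫₀¹ C_G(u) sin(π · 0.473275 · (17/(14 + 6·10⁻⁶)) u)/u du`. A closed-form
real inequality (no `ζ`, no `χ`); CLAIM ("computer calculation"), to be discharged by certified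
numerics, NOT proved here. [claim: BondarenkoHeap2026, status: under-review] -/
def numericalInequality8 : Prop :=
  1 < mainTerm8 (1 / 10 ^ 6) 0.473275 G₀star

/-- **The deduction of (8) from Proposition 1 and Theorems 3–4** ("Applying these two asymptotics
gives (8)", p. 9, TeX l.405), as an implication between the typed statements (with (3): `Ŵ_T(0) ≍ T`,
and `C_Φ > 0`, which make `I₀ → ∞` so that Proposition 1's `O_ε(T^{−C})` is `o(I₀)`, and the
extension step `𝓘₁/𝓘₀ = I₁/I₀ + O(T^{−C})` of p. 6). Bookkeeping to be PROVED (prover phase); typed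
now so the DAG is closed. [claim: BondarenkoHeap2026, status: under-review] -/
def equation8_glue : Prop :=
  proposition1 → theorem3 → theorem4 → cPhi_pos → weightHat_zero → extensionToLine → equation8

/-- **Assembly of Theorem 1** ("Proof of Theorem 1", p. 9, TeX l.404–423) as an implication from the
typed internal statements of §2 to the EXISTING apex claim `bondarenkoHeap2026_theorem1`
(`∃ E₀ ≥ 10, SiegelZerosOfQuality E₀ → RiemannHypothesis → ZetaGapLiminfBelow 0.4733`): equation (8)
and the numerical inequality give `𝓘₁ > 𝓘₀` along the exceptional sequence for `ε` small, `𝓔` large,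
`q` large, whence (small-gaps criterion, PROVED above) gaps of normalised size `≤ c(1+ε)(1+o(1))
< 0.4733` at heights `→ ∞`. Neither antecedent mentions `ζ`-gaps or the apex (referee tests T-1/T-2);
RH is `ζ`-only and enters through `equation8` (T-3). PROVED below (`theorem1_assembly_holds`).
[claim: BondarenkoHeap2026, status: under-review] -/
def theorem1_assembly : Prop :=
  equation8 → numericalInequality8 → bondarenkoHeap2026_theorem1

/-! ### §2.3 — proved bookkeeping -/

/-- **(5)**: `log L/log T = 17/(14 + 6δ) = ϑ_δ` for `q ≥ 2` (and `7/3 + δ ≠ 0`).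
[cite: BondarenkoHeap2026, §2.3 (5) p. 8] -/
theorem theta_eq (ρ : Resonator) {q : ℕ} (hq : 2 ≤ q) :
    Real.log (lengthL q) / Real.log (ρ.T q) = theta ρ.δ := by
  have hq0 : (0 : ℝ) < q := by exact_mod_cast (by omega : 0 < q)
  have hlogq : 0 < Real.log q := Real.log_pos (by exact_mod_cast hq)
  have hδ := ρ.δ_pos
  rw [lengthL, Resonator.T, Real.log_rpow hq0, Real.log_rpow hq0, theta]
  field_simp
  ring

/-- `L = T · q^{1/2 − δ}` ((5), p. 8). [cite: BondarenkoHeap2026, §2.3 (5) p. 8] -/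
theorem lengthL_eq (ρ : Resonator) {q : ℕ} (hq : 1 ≤ q) :
    lengthL q = ρ.T q * (q : ℝ) ^ (1 / 2 - ρ.δ) := by
  have hq0 : (0 : ℝ) < q := by exact_mod_cast (by omega : 0 < q)
  rw [lengthL, Resonator.T, ← Real.rpow_add hq0]
  norm_num

/-- A quadratic character takes real values: `χ(n) = Re χ(n)` (so `r(n) = χ(n)G(n)` is the real
sequence `Resonator.coeff`; "χ is the primitive quadratic character modulo q", p. 8, "real
coefficients r(n)", p. 5). [cite: BondarenkoHeap2026, §2.3 p. 8 (χ quadratic) and §2.1 p. 5 (real coefficients)] -/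
theorem re_quadratic {q : ℕ} {χ : DirichletCharacter ℂ q} (hχ : χ.IsQuadratic) (a : ZMod q) :
    ((χ a).re : ℂ) = χ a := by
  rcases hχ a with h | h | h <;> simp [h]

/-- `D_G ≥ 0`. [cite: BondarenkoHeap2026, Theorem 3 (7) p. 8] -/
theorem dG_nonneg (G₀ : Polynomial ℝ) : 0 ≤ dG G₀ :=
  intervalIntegral.integral_nonneg (by norm_num) fun x _ ↦ sq_nonneg _

/-- The proof's constant sits below the theorem's: `0.473275 < 0.4733` (so a gap of normalised size
`≤ c(1+ε)(1+o(1))` with `c = 0.473275` is eventually `< 0.4733` once `ε < 10⁻⁵`, say).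
[cite: BondarenkoHeap2026, Theorem 1 p. 2 and proof of Theorem 1 p. 9] -/
theorem cStar_lt : (0.473275 : ℝ) * (1 + 1 / 10 ^ 5) < 0.4733 := by norm_num


/-! ### Appended 2026-08-26 (prover phase): DISCHARGE of the assembly `theorem1_assembly`

"Proof of Theorem 1" (p. 9) carried out against the typed internal statements: we fix the
printed data (`δ = 10⁻⁶`, `c = 0.473275`, `G₀ = 1 − (63/125)(x − 1/2)²`), an explicit admissible
bump `φ` and cut-off profile `f₀`, choose `ε` small against the margin of the numerical
inequality, `B` large as (8) demands, `E₀` large against the `O(1/√log 𝓔)`-constant, and run: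
(8) + numerics ⇒ `𝓘₁/𝓘₀ > 1 + 3μ/8 > 1` ⇒ `𝓘₁ > 𝓘₀` on the
window (`𝓘₁/𝓘₀ > 1`, and `𝓘₀ ≥ 0`); small-gaps criterion (proved above) ⇒ a normalised gap
`≤ c(1 + 2ε) ≤ 0.473275(1 + 10⁻⁵) < 0.4733` near height `T = q^{7/3+δ} → ∞`. RH (for `ζ` only) is used
exactly where (8) needs it; if RH fails the apex implication is vacuous. NOT RH-BEARING: this proves an implication between
claims of print and the typed apex claim; nothing here bears on the truth of RH. -/

namespace Assembly

/-- The bump used in the assembly: `φ(ξ) = s(1 + 2ξ) s(1 − 2ξ)` with `s` Mathlib's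
`Real.smoothTransition` (smooth, even, `φ(0) = 1`, supported in `[−1/2, 1/2] ⊂ (−1, 1)`).
[cite: BondarenkoHeap2026, §2.1 p. 5 (φ and σ)] -/
def phiStar (ξ : ℝ) : ℝ :=
  Real.smoothTransition (1 + 2 * ξ) * Real.smoothTransition (1 - 2 * ξ)

/-- `φ⋆` vanishes outside `[−1/2, 1/2]`. [cite: BondarenkoHeap2026, §2.1 p. 5 (φ and σ)] -/
theorem phiStar_eq_zero {ξ : ℝ} (h : ξ ∉ Set.Icc (-(1 / 2 : ℝ)) (1 / 2)) : phiStar ξ = 0 := by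
  rw [Set.mem_Icc, not_and_or, not_le, not_le] at h
  rcases h with h | h
  · rw [phiStar, Real.smoothTransition.zero_of_nonpos (x := 1 + 2 * ξ) (by linarith), zero_mul]
  · rw [phiStar, Real.smoothTransition.zero_of_nonpos (x := 1 - 2 * ξ) (by linarith), mul_zero]

/-- The admissible bump datum `(σ, φ) = (1, φ⋆)`. [cite: BondarenkoHeap2026, §2.1 p. 5 (φ and σ)] -/
def bumpStar : Bump where
  σ := 1
  φ := phiStar
  σ_pos := one_pos
  smooth := by
    unfold phiStar
    exact (Real.smoothTransition.contDiff.comp (contDiff_const.add (contDiff_const.mul contDiff_id))).mul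
      (Real.smoothTransition.contDiff.comp (contDiff_const.sub (contDiff_const.mul contDiff_id)))
  tsupport_subset := by
    refine (closure_minimal (Function.support_subset_iff'.2 fun ξ hξ ↦ phiStar_eq_zero hξ)
      isClosed_Icc).trans ?_
    intro ξ hξ
    exact ⟨by linarith [hξ.1], by linarith [hξ.2]⟩
  even := fun ξ ↦ by
    show Real.smoothTransition (1 + 2 * -ξ) * Real.smoothTransition (1 - 2 * -ξ) =
      Real.smoothTransition (1 + 2 * ξ) * Real.smoothTransition (1 - 2 * ξ)
    rw [show (1 : ℝ) + 2 * -ξ = 1 - 2 * ξ by ring, show (1 : ℝ) - 2 * -ξ = 1 + 2 * ξ by ring, mul_comm]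
  ne_zero := fun h ↦ by
    have h0 := congr_fun h 0
    simp [phiStar, Real.smoothTransition.one] at h0

/-- The cut-off profile used in the assembly: `f₀(x) = s(2 − 2x)` (`= 1` on `[0, 1/2]`, antitone,
`= 0` on `[1, ∞)`). [cite: BondarenkoHeap2026, §2.3 p. 8 (G(n))] -/
def fStar (x : ℝ) : ℝ :=
  Real.smoothTransition (2 - 2 * x)

/-- The resonator datum of the proof of Theorem 1: `δ = 10⁻⁶`, `G₀ = G₀⋆`, `f₀ = f⋆`.
[cite: BondarenkoHeap2026, proof of Theorem 1 p. 9] -/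
def resonatorStar : Resonator where
  δ := 1 / 10 ^ 6
  G₀ := G₀star
  f₀ := fStar
  δ_pos := by norm_num
  δ_lt := by norm_num
  f₀_smooth := by
    unfold fStar
    exact Real.smoothTransition.contDiff.comp (contDiff_const.sub (contDiff_const.mul contDiff_id))
  f₀_eq_one := fun x hx ↦ Real.smoothTransition.one_of_one_le (by rw [Set.mem_Icc] at hx; linarith)
  f₀_antitoneOn := fun x _ y _ hxy ↦ Real.smoothTransition.monotone (by linarith)
  f₀_eq_zero := fun x hx ↦ Real.smoothTransition.zero_of_nonpos (by linarith)

/-- `T(q) = q^{7/3+δ} → ∞`. [cite: BondarenkoHeap2026, §2.3 (5) p. 8] -/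
theorem tendsto_T (ρ : Resonator) : Tendsto (fun q : ℕ ↦ ρ.T q) atTop atTop :=
  (tendsto_rpow_atTop (by linarith [ρ.δ_pos] : (0 : ℝ) < 7 / 3 + ρ.δ)).comp
    tendsto_natCast_atTop_atTop


/-- Choice of `E₀`: for `E ≥ max 10 (exp((4A/μ)² + 1))` the `O(1/√log E)` term is `≤ μ/4`.
[cite: BondarenkoHeap2026, proof of Theorem 1 p. 9] -/
theorem div_sqrt_log_le {A μ E : ℝ} (hA : 0 ≤ A) (hμ : 0 < μ)
    (hE : max 10 (Real.exp ((4 * A / μ) ^ 2 + 1)) ≤ E) : A / Real.sqrt (Real.log E) ≤ μ / 4 := by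
  have hE10 : (10 : ℝ) ≤ E := (le_max_left _ _).trans hE
  have hlogE : (4 * A / μ) ^ 2 + 1 ≤ Real.log E := by
    rw [Real.le_log_iff_exp_le (by linarith)]
    exact (le_max_right _ _).trans hE
  have hsqrt : 4 * A / μ < Real.sqrt (Real.log E) := Real.lt_sqrt_of_sq_lt (by linarith)
  have hsqrt0 : 0 < Real.sqrt (Real.log E) := lt_of_le_of_lt (by positivity) hsqrt
  rw [div_le_iff₀ hsqrt0]
  have h := (div_lt_iff₀ hμ).mp hsqrt
  nlinarith

/-- `h/2 = πc/log T ≤ 4` for `c ≤ 1` and `T ≥ 7`. [cite: BondarenkoHeap2026, §2.1 p. 5 (h)] -/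
theorem gapWidth_half_le_four {c T : ℝ} (hc0 : 0 ≤ c) (hc1 : c ≤ 1) (hT : 7 ≤ T) :
    gapWidth c T / 2 ≤ 4 := by
  have hT0 : 0 < T := by linarith
  have hlogT1 : 1 ≤ Real.log T := by
    rw [Real.le_log_iff_exp_le hT0]
    have := Real.exp_one_lt_d9
    linarith
  rw [gapWidth]
  have h1 : 2 * π * c / Real.log T ≤ 2 * π * c := div_le_self (by positivity) hlogT1
  have h2 : 2 * π * c ≤ 2 * π := mul_le_of_le_one_right (by positivity) hc1
  linarith [Real.pi_lt_four]

/-- The normalised size delivered by the criterion is `≤ c(1 + 2ε)` once `T ≥ 7` and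
`T^ε ≥ 2`. [cite: BondarenkoHeap2026, §2.1 p. 5 (small gaps criterion)] -/
theorem gapBound_le {c ε T : ℝ} (hc0 : 0 ≤ c) (hc1 : c ≤ 1) (hε : 0 < ε) (hT : 7 ≤ T)
    (hlog2 : Real.log 2 / ε ≤ Real.log T) :
    c * Real.log (T ^ (1 + ε) + gapWidth c T / 2) / Real.log T ≤ c * (1 + 2 * ε) := by
  have hT0 : 0 < T := by linarith
  have hT1 : 1 < T := by linarith
  have hlogT0 : 0 < Real.log T := Real.log_pos hT1
  have hh4 := gapWidth_half_le_four hc0 hc1 hT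
  have hh0 : 0 ≤ gapWidth c T / 2 := by
    have := gapWidth_nonneg hc0 hT1.le; linarith
  have hpos : 0 < T ^ (1 + ε) := Real.rpow_pos_of_pos hT0 _
  have hT1ε : T ≤ T ^ (1 + ε) := by
    conv_lhs => rw [← Real.rpow_one T]
    exact Real.rpow_le_rpow_of_exponent_le hT1.le (by linarith)
  have hle2 : T ^ (1 + ε) + gapWidth c T / 2 ≤ 2 * T ^ (1 + ε) := by linarith
  have hlogarg : Real.log (T ^ (1 + ε) + gapWidth c T / 2) ≤ (1 + 2 * ε) * Real.log T := by
    calc Real.log (T ^ (1 + ε) + gapWidth c T / 2) ≤ Real.log (2 * T ^ (1 + ε)) :=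
          Real.log_le_log (by linarith) hle2
      _ = Real.log 2 + (1 + ε) * Real.log T := by
          rw [Real.log_mul two_ne_zero hpos.ne', Real.log_rpow hT0]
      _ ≤ ε * Real.log T + (1 + ε) * Real.log T := by
          have : Real.log 2 ≤ ε * Real.log T := by
            have := (div_le_iff₀ hε).mp hlog2
            linarith
          linarith
      _ = (1 + 2 * ε) * Real.log T := by ring
  calc c * Real.log (T ^ (1 + ε) + gapWidth c T / 2) / Real.log T
      ≤ c * ((1 + 2 * ε) * Real.log T) / Real.log T := by gcongr
    _ = c * (1 + 2 * ε) := by rw [← mul_assoc, mul_div_assoc, div_self hlogT0.ne', mul_one]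

end Assembly

open Assembly in
/-- **DISCHARGE of the assembly**: `theorem1_assembly` holds — equation (8) and the numerical
inequality imply the apex claim `bondarenkoHeap2026_theorem1` (`∃ E₀ ≥ 10, SiegelZerosOfQuality E₀ →
RiemannHypothesis → ZetaGapLiminfBelow 0.4733`). This is the "Proof of Theorem 1" paragraph of p. 9
(TeX l.404–423) run against the PROVED small-gaps criterion, with every
`ε`/`𝓔`/`q`-threshold made explicit. NOT RH-BEARING (an implication between claims of print).
[claim: BondarenkoHeap2026, status: under-review] -/
theorem theorem1_assembly_holds : theorem1_assembly := by
  intro hEq8 hNum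
  -- the printed data
  set c : ℝ := 0.473275 with hc_def
  have hc0 : 0 < c := by norm_num [hc_def]
  have hc1 : c ≤ 1 := by norm_num [hc_def]
  set ρ : Resonator := resonatorStar with hρ_def
  set w : Bump := bumpStar with hw_def
  have hρδ : ρ.δ = 1 / 10 ^ 6 := rfl
  have hρG : ρ.G₀ = G₀star := rfl
  -- the numerical inequality: main term `= 1 + μ`, `μ > 0`
  have hmain : 1 < mainTerm8 ρ.δ c ρ.G₀ := by rw [hρδ, hρG]; exact hNum
  obtain ⟨μ, hμ_def⟩ : ∃ μ : ℝ, μ = mainTerm8 ρ.δ c ρ.G₀ - 1 := ⟨_, rfl⟩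
  have hμ : 0 < μ := by rw [hμ_def]; linarith
  have hDG : dG ρ.G₀ ≠ 0 := by
    intro h
    have : mainTerm8 ρ.δ c ρ.G₀ = c := by simp [mainTerm8, h]
    rw [this] at hmain; norm_num [hc_def] at hmain
  have hSI : sineIntegralCG ρ.δ c ρ.G₀ ≠ 0 := by
    intro h
    have : mainTerm8 ρ.δ c ρ.G₀ = c := by simp [mainTerm8, h]
    rw [this] at hmain; norm_num [hc_def] at hmain
  have hG0 : ρ.G₀ ≠ 0 := by
    intro h; apply hDG; simp [dG, h]
  -- without RH the apex implication is vacuous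
  by_cases hRH : RiemannHypothesis
  swap
  · exact ⟨10, le_rfl, fun _ h ↦ absurd h hRH⟩
  -- (8): the `O(ε)`-constant `K`
  obtain ⟨K, hK0, hK⟩ := hEq8 hRH c hc0 hc1 w ρ hG0 hSI
  -- choose `ε`
  set ε : ℝ := min (1 / 2) (min (μ / (4 * (K + 1))) (1 / (2 * 10 ^ 5))) with hε_def
  have hε0 : 0 < ε := by
    rw [hε_def]; exact lt_min (by norm_num) (lt_min (by positivity) (by norm_num))
  have hε_half : ε ≤ 1 / 2 := min_le_left _ _
  have hε1 : ε < 1 := by linarith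
  have hεK : K * ε ≤ μ / 4 := by
    have h1 : ε ≤ μ / (4 * (K + 1)) := (min_le_right _ _).trans (min_le_left _ _)
    have hK1 : 0 < K + 1 := by linarith
    calc K * ε ≤ K * (μ / (4 * (K + 1))) := by gcongr
      _ ≤ (K + 1) * (μ / (4 * (K + 1))) := by gcongr; linarith
      _ = μ / 4 := by field_simp
  have hε5 : 2 * ε ≤ 1 / 10 ^ 5 := by
    have : ε ≤ 1 / (2 * 10 ^ 5) := (min_le_right _ _).trans (min_le_right _ _)
    linarith
  -- `B` large for (8); then the `O(1/√log 𝓔)`-constant `A`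
  obtain ⟨B₀, hB₀⟩ := hK ε hε0 hε1
  obtain ⟨A, hA0, hA⟩ := hB₀ B₀ le_rfl
  set B : ℕ := B₀ with hB_def
  -- `E₀`: large against `A`
  set E₀ : ℝ := max 10 (Real.exp ((4 * A / μ) ^ 2 + 1)) with hE₀_def
  have hAE : ∀ E : ℝ, E₀ ≤ E → A / Real.sqrt (Real.log E) ≤ μ / 4 :=
    fun E hE ↦ div_sqrt_log_le hA0 hμ hE
  refine ⟨E₀, le_max_left _ _, fun hSZ _ ↦ ?_⟩
  -- target: `ZetaGapLiminfBelow 0.4733`, witnessed by `c' = c(1 + 10⁻⁵)`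
  refine ⟨c * (1 + 1 / 10 ^ 5), by rw [hc_def]; exact cStar_lt, ?_⟩
  rw [Filter.frequently_atTop]
  intro N
  -- thresholds in `q`
  obtain ⟨q₁, hq₁⟩ := hA (μ / 8) (by positivity)
  have hTend := tendsto_T ρ
  have hlogTend : Tendsto (fun q : ℕ ↦ Real.log (ρ.T q)) atTop atTop :=
    Real.tendsto_log_atTop.comp hTend
  have hev : ∀ᶠ q : ℕ in atTop, q₁ ≤ q ∧ 7 ≤ ρ.T q ∧ Real.log 2 / ε ≤ Real.log (ρ.T q) ∧
      (zetaOrdinate N + 4) ^ 2 ≤ ρ.T q := by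
    filter_upwards [eventually_ge_atTop q₁, hTend.eventually_ge_atTop 7,
      hlogTend.eventually_ge_atTop (Real.log 2 / ε),
      hTend.eventually_ge_atTop ((zetaOrdinate N + 4) ^ 2)] with q h1 h2 h3 h4
    exact ⟨h1, h2, h3, h4⟩
  obtain ⟨Q, hQ⟩ := Filter.eventually_atTop.mp hev
  -- an exceptional character of quality `≥ E₀` at a conductor `q ≥ Q`
  obtain ⟨q, hqne, χ, E, hQq, hE₀E, hSiegel⟩ := hSZ Q
  obtain ⟨hqq₁, hT7, hlog2, hγN⟩ := hQ q hQq
  -- (8) at this `q`, the gap bound, and abbreviations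
  have h8 := hq₁ q χ E hqq₁ hSiegel
  have hgap := gapBound_le hc0.le hc1 hε0 hT7 hlog2
  have hh4 := gapWidth_half_le_four hc0.le hc1 hT7
  have hI0nn := I0_nonneg ε w B (ρ.coeff χ) (lengthL q) (ρ.T q)
  set T : ℝ := ρ.T q with hT_def
  set L : ℝ := lengthL q with hL_def
  set r : ℕ → ℝ := ρ.coeff χ with hr_def
  have hT1 : 1 < T := by linarith
  -- (8) + numerics: `𝓘₁/𝓘₀ ≥ 1 + 3μ/8 > 1`, hence `𝓘₀ > 0` and `𝓘₁ > 𝓘₀`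
  have hAE' := hAE E hE₀E
  have hratio : 1 < I1 c ε w B r L T / I0 ε w B r L T := by
    have h := (abs_le.mp h8).1
    have hm : mainTerm8 ρ.δ c ρ.G₀ = 1 + μ := by rw [hμ_def]; ring
    rw [hm] at h
    linarith [h, hεK, hAE']
  have hI0pos : 0 < I0 ε w B r L T := by
    rcases hI0nn.lt_or_eq with h | h
    · exact h
    · rw [← h, div_zero] at hratio; linarith
  have hI : I0 ε w B r L T < I1 c ε w B r L T := (one_lt_div hI0pos).mp hratio
  -- the small-gaps criterion
  obtain ⟨m, hγlow, -, -, hδ⟩ := smallGaps_criterion hc0.le hT1 hI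
  have hδ' : zetaNormalizedGap m ≤ c * (1 + 1 / 10 ^ 5) := by
    calc zetaNormalizedGap m ≤ c * Real.log (T ^ (1 + ε) + gapWidth c T / 2) / Real.log T := hδ
      _ ≤ c * (1 + 2 * ε) := hgap
      _ ≤ c * (1 + 1 / 10 ^ 5) := mul_le_mul_of_nonneg_left (by linarith) hc0.le
  -- the index `m` is beyond `N`: `γ_m > T^{1-ε} − h/2 ≥ √T − 4 ≥ γ_N`
  have hTε : Real.sqrt T ≤ T ^ (1 - ε) := by
    rw [Real.sqrt_eq_rpow]
    exact Real.rpow_le_rpow_of_exponent_le hT1.le (by linarith)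
  have hγNm : zetaOrdinate N < zetaOrdinate m := by
    have h1 : zetaOrdinate N + 4 ≤ Real.sqrt T := Real.le_sqrt_of_sq_le hγN
    linarith
  refine ⟨m, ?_, hδ'⟩
  by_contra hmN
  exact absurd (zetaOrdinate_mono_holds (not_le.mp hmN).le) (not_le.mpr hγNm)


/-! ### Appended 2026-08-26 (prover phase): DISCHARGE of `equation8_glue`

"Applying these two asymptotics gives (8)" (p. 9, TeX l.405): with `I₁ = cI₀ − (2/π)J + O₁(εI₀)
+ o(I₀) + O_ε(T^{−C})` (Proposition 1 for `r = χ·G`, `C = 1`, `L ≤ T²`), `I₀ = (1 + o(1))D_G S(q)`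
(Theorem 3), `J = −(1 + o(1) + O(1/√log 𝓔)) S(q)·∫₀¹ C_G sin/u` (Theorem 4), `S(q) → ∞` (from (3)
and `C_Φ > 0`) and `𝓘₁/𝓘₀ = I₁/I₀ + O(T^{−1})` (extension to `ℝ`), one gets
`|𝓘₁/𝓘₀ − (c + (2/(πD_G))∫₀¹ C_G sin/u)| ≤ ε + A/√log 𝓔 + η` for `q` large. Pure bookkeeping of
real inequalities; NOT RH-BEARING. -/

namespace Glue

/-- `D_G = ∫₀¹ G₀² > 0` for a non-zero polynomial `G₀` (finitely many roots).
[cite: BondarenkoHeap2026, Theorem 3 (7) p. 8] -/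
theorem dG_pos {G₀ : Polynomial ℝ} (hG : G₀ ≠ 0) : 0 < dG G₀ := by
  unfold dG
  have hcont : Continuous fun x : ℝ ↦ (G₀.eval x) ^ 2 := G₀.continuous.pow 2
  rw [intervalIntegral.integral_pos_iff_support_of_nonneg_ae
    (Eventually.of_forall fun x ↦ sq_nonneg _) (hcont.intervalIntegrable 0 1)]
  refine ⟨one_pos, ?_⟩
  have hR : volume {x : ℝ | G₀.IsRoot x} = 0 := (G₀.finite_setOf_isRoot hG).measure_zero volume
  have hsub : Set.Ioc (0 : ℝ) 1 \ {x | G₀.IsRoot x} ⊆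
      (Function.support fun x : ℝ ↦ (G₀.eval x) ^ 2) ∩ Set.Ioc 0 1 := by
    rintro x ⟨hx, hnr⟩
    exact ⟨Function.mem_support.mpr (pow_ne_zero 2 hnr), hx⟩
  calc (0 : ENNReal) < volume (Set.Ioc (0 : ℝ) 1 \ {x | G₀.IsRoot x}) := by
        rw [measure_sdiff_null hR, Real.volume_Ioc]; norm_num
    _ ≤ _ := measure_mono hsub

/-- `|f₀| ≤ 1` on `[0, ∞)` for any cut-off profile of a resonator datum.
[cite: BondarenkoHeap2026, §2.3 p. 8 (G(n))] -/
theorem abs_f₀_le_one (ρ : Resonator) {x : ℝ} (hx : 0 ≤ x) : |ρ.f₀ x| ≤ 1 := by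
  have h1 : ρ.f₀ (1 / 2) = 1 := ρ.f₀_eq_one _ ⟨by norm_num, le_rfl⟩
  have h0 : ρ.f₀ 1 = 0 := ρ.f₀_eq_zero 1 le_rfl
  rcases le_or_gt x (1 / 2) with hx2 | hx2
  · rw [ρ.f₀_eq_one x ⟨hx, hx2⟩, abs_one]
  rcases le_or_gt x 1 with hx1 | hx1
  · have hmem : x ∈ Set.Icc (1 / 2 : ℝ) 1 := ⟨hx2.le, hx1⟩
    have hup : ρ.f₀ x ≤ ρ.f₀ (1 / 2) := ρ.f₀_antitoneOn ⟨le_rfl, by norm_num⟩ hmem hx2.le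
    have hlo : ρ.f₀ 1 ≤ ρ.f₀ x := ρ.f₀_antitoneOn hmem ⟨by norm_num, le_rfl⟩ hx1
    rw [abs_le]; constructor <;> linarith
  · rw [ρ.f₀_eq_zero x hx1.le, abs_zero]; exact zero_le_one

/-- The resonator coefficients are uniformly bounded: `|χ(n)G(n)| ≤ M` with `M = sup_{[0,1]} |G₀|`
(for `q ≥ 1`, `n ≥ 1`). [cite: BondarenkoHeap2026, §2.3 p. 8 (G(n))] -/
theorem exists_coeff_bound (ρ : Resonator) : ∃ M : ℝ, 0 ≤ M ∧
    ∀ (q : ℕ) (χ : DirichletCharacter ℂ q) (n : ℕ), 1 ≤ q → 1 ≤ n → |ρ.coeff χ n| ≤ M := by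
  obtain ⟨M, hM⟩ := isCompact_Icc.exists_bound_of_continuousOn
    (ρ.G₀.continuous.continuousOn (s := Set.Icc (0 : ℝ) 1))
  refine ⟨max M 0, le_max_right _ _, fun q χ n hq hn ↦ ?_⟩
  have hq1 : (1 : ℝ) ≤ q := by exact_mod_cast hq
  have hL1 : 1 ≤ lengthL q := Real.one_le_rpow hq1 (by norm_num)
  have hL0 : 0 < lengthL q := by linarith
  have hn1 : (1 : ℝ) ≤ n := by exact_mod_cast hn
  have hχ : |(χ (n : ZMod q)).re| ≤ 1 := (Complex.abs_re_le_norm _).trans (χ.norm_le_one _)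
  rw [Resonator.coeff, abs_mul, Resonator.G, abs_mul]
  by_cases hnL : (n : ℝ) < lengthL q
  · have hlogL : 0 < Real.log (lengthL q) := Real.log_pos (by linarith)
    have hx : Real.log n / Real.log (lengthL q) ∈ Set.Icc (0 : ℝ) 1 :=
      ⟨div_nonneg (Real.log_nonneg hn1) hlogL.le,
        div_le_one_of_le₀ (Real.log_le_log (by linarith) hnL.le) hlogL.le⟩
    have hG := hM _ hx
    rw [Real.norm_eq_abs] at hG
    have hMnn : 0 ≤ M := (abs_nonneg _).trans hG
    have hf := abs_f₀_le_one ρ (div_nonneg (by linarith) hL0.le : (0 : ℝ) ≤ n / lengthL q)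
    have s1 : |ρ.G₀.eval (Real.log n / Real.log (lengthL q))| * |ρ.f₀ (n / lengthL q)| ≤ M * 1 :=
      mul_le_mul hG hf (abs_nonneg _) hMnn
    have s2 : |(χ (n : ZMod q)).re| *
        (|ρ.G₀.eval (Real.log n / Real.log (lengthL q))| * |ρ.f₀ (n / lengthL q)|) ≤ 1 * (M * 1) :=
      mul_le_mul hχ s1 (by positivity) zero_le_one
    calc |(χ (n : ZMod q)).re| *
          (|ρ.G₀.eval (Real.log n / Real.log (lengthL q))| * |ρ.f₀ (n / lengthL q)|)
        ≤ 1 * (M * 1) := s2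
      _ ≤ max M 0 := by rw [one_mul, mul_one]; exact le_max_left _ _
  · have hf0 : ρ.f₀ (n / lengthL q) = 0 :=
      ρ.f₀_eq_zero _ ((one_le_div hL0).mpr (not_lt.mp hnL))
    rw [hf0, abs_zero, mul_zero, mul_zero]
    exact le_max_right _ _

/-- `T(q)/q = q^{4/3+δ} → ∞`. [cite: BondarenkoHeap2026, §2.3 (5) p. 8] -/
theorem tendsto_T_div (ρ : Resonator) : Tendsto (fun q : ℕ ↦ ρ.T q / q) atTop atTop := by
  have h : Tendsto (fun q : ℕ ↦ (q : ℝ) ^ (4 / 3 + ρ.δ)) atTop atTop :=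
    (tendsto_rpow_atTop (by linarith [ρ.δ_pos] : (0 : ℝ) < 4 / 3 + ρ.δ)).comp
      tendsto_natCast_atTop_atTop
  refine h.congr' ?_
  filter_upwards [eventually_gt_atTop 0] with q hq
  have hq0 : (0 : ℝ) < q := by exact_mod_cast hq
  rw [Resonator.T, eq_div_iff hq0.ne', ← Real.rpow_add_one hq0.ne']
  congr 1; ring

/-- `1 ≤ L ≤ T²` for `q ≥ 1`. [cite: BondarenkoHeap2026, §2.3 (5) p. 8] -/
theorem lengthL_le_T_sq (ρ : Resonator) {q : ℕ} (hq : 1 ≤ q) :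
    1 ≤ lengthL q ∧ lengthL q ≤ ρ.T q ^ (2 : ℝ) := by
  have hq1 : (1 : ℝ) ≤ q := by exact_mod_cast hq
  refine ⟨Real.one_le_rpow hq1 (by norm_num), ?_⟩
  rw [Resonator.T, ← Real.rpow_mul (by linarith)]
  exact Real.rpow_le_rpow_of_exponent_le hq1 (by linarith [ρ.δ_pos])

/-- The real-inequality core of "applying these two asymptotics": from the three displayed
approximations (Proposition 1, Theorem 3, Theorem 4 in relative form) to the bound for
`I₁/I₀ − (c + (2/(πD))·SI)`. [cite: BondarenkoHeap2026, (8) p. 9] -/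
theorem ratio_core {I₀ I₁ Jv Sc SI D c ε η₁ η₃ e₄ K : ℝ}
    (hD : 0 < D) (hSc : 0 < Sc) (hη₃ : 0 ≤ η₃) (hη₃' : η₃ ≤ 1 / 2) (he₄ : 0 ≤ e₄) (hK : 0 ≤ K)
    (hI₀one : 1 ≤ I₀)
    (h3 : |I₀ - D * Sc| ≤ η₃ * (D * Sc))
    (h1 : |I₁ - (c * I₀ - 2 / π * Jv)| ≤ ε * I₀ + η₁ * I₀ + K)
    (h4 : |Jv + Sc * SI| ≤ e₄ * |Sc * SI|) :
    |I₁ / I₀ - (c + 2 / (π * D) * SI)| ≤ ε + η₁ + K + 4 * |SI| / (π * D) * (η₃ + e₄) := by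
  have hI₀ : 0 < I₀ := by linarith
  have hD0 : D ≠ 0 := hD.ne'
  have hDS : 0 < D * Sc := mul_pos hD hSc
  have hI₀low : D * Sc / 2 ≤ I₀ := by
    have h := (abs_le.mp h3).1
    have h' : η₃ * (D * Sc) ≤ 1 / 2 * (D * Sc) := mul_le_mul_of_nonneg_right hη₃' hDS.le
    linarith
  -- the exact decomposition of `I₁ − main·I₀`
  have hdec : I₁ - (c + 2 / (π * D) * SI) * I₀ =
      (I₁ - (c * I₀ - 2 / π * Jv)) - 2 / π * (Jv + Sc * SI) - 2 / π * (SI / D) * (I₀ - D * Sc) := by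
    field_simp
    ring
  have hπ : 0 < π := Real.pi_pos
  have hSSI : |Sc * SI| = Sc * |SI| := by rw [abs_mul, abs_of_pos hSc]
  -- bound the numerator
  have hnum : |I₁ - (c + 2 / (π * D) * SI) * I₀| ≤
      (ε + η₁) * I₀ + K + 2 / π * (Sc * |SI|) * (e₄ + η₃) := by
    rw [hdec]
    have hA := h1
    have hB : |2 / π * (Jv + Sc * SI)| ≤ 2 / π * (e₄ * (Sc * |SI|)) := by
      rw [abs_mul, abs_of_pos (by positivity : (0 : ℝ) < 2 / π), ← hSSI]
      exact mul_le_mul_of_nonneg_left h4 (by positivity)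
    have hC : |2 / π * (SI / D) * (I₀ - D * Sc)| ≤ 2 / π * (|SI| / D) * (η₃ * (D * Sc)) := by
      rw [abs_mul, abs_mul, abs_of_pos (by positivity : (0 : ℝ) < 2 / π), abs_div,
        abs_of_pos hD]
      exact mul_le_mul_of_nonneg_left h3 (by positivity)
    calc |I₁ - (c * I₀ - 2 / π * Jv) - 2 / π * (Jv + Sc * SI) - 2 / π * (SI / D) * (I₀ - D * Sc)|
        ≤ |I₁ - (c * I₀ - 2 / π * Jv) - 2 / π * (Jv + Sc * SI)| +
            |2 / π * (SI / D) * (I₀ - D * Sc)| := abs_sub _ _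
      _ ≤ (|I₁ - (c * I₀ - 2 / π * Jv)| + |2 / π * (Jv + Sc * SI)|) +
            |2 / π * (SI / D) * (I₀ - D * Sc)| := by gcongr; exact abs_sub _ _
      _ ≤ (ε * I₀ + η₁ * I₀ + K) + 2 / π * (e₄ * (Sc * |SI|)) +
            2 / π * (|SI| / D) * (η₃ * (D * Sc)) := by gcongr
      _ = (ε + η₁) * I₀ + K + 2 / π * (Sc * |SI|) * (e₄ + η₃) := by
          field_simp
          ring
  -- divide by `I₀`
  have hquot : I₁ / I₀ - (c + 2 / (π * D) * SI) = (I₁ - (c + 2 / (π * D) * SI) * I₀) / I₀ := by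
    field_simp
  rw [hquot, abs_div, abs_of_pos hI₀, div_le_iff₀ hI₀]
  refine hnum.trans ?_
  have h2 : 2 / π * (Sc * |SI|) * (e₄ + η₃) ≤ 4 * |SI| / (π * D) * (η₃ + e₄) * I₀ := by
    calc 2 / π * (Sc * |SI|) * (e₄ + η₃)
        = 4 * |SI| / (π * D) * (η₃ + e₄) * (D * Sc / 2) := by field_simp; ring
      _ ≤ 4 * |SI| / (π * D) * (η₃ + e₄) * I₀ := by
          exact mul_le_mul_of_nonneg_left hI₀low (by positivity)
  have h3' : K ≤ K * I₀ := le_mul_of_one_le_right hK hI₀one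
  have h4' : (ε + η₁ + K + 4 * |SI| / (π * D) * (η₃ + e₄)) * I₀ =
      (ε + η₁) * I₀ + K * I₀ + 4 * |SI| / (π * D) * (η₃ + e₄) * I₀ := by ring
  rw [h4']
  linarith

end Glue

open Glue in
/-- **DISCHARGE of the glue**: `equation8_glue` holds — Proposition 1, Theorem 3, Theorem 4,
`C_Φ > 0`, (3) and the extension to `ℝ` imply equation (8) in its typed form (with `K = 1` as the
`O(ε)`-constant, as the printed `O₁(εI₀)` gives). "Applying these two asymptotics gives (8)"
(p. 9, TeX l.405). NOT RH-BEARING. [claim: BondarenkoHeap2026, status: under-review] -/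
theorem equation8_glue_holds : equation8_glue := by
  intro hP1 hT3 hT4 hC hW hExt hRH c hc0 hc1 w ρ hG0 hSI
  have hDpos : 0 < dG ρ.G₀ := dG_pos hG0
  set D : ℝ := dG ρ.G₀ with hD_def
  set SI : ℝ := sineIntegralCG ρ.δ c ρ.G₀ with hSI_def
  -- coefficient bound `|χ(n)G(n)| ≤ M`
  obtain ⟨M, hM0, hM⟩ := exists_coeff_bound ρ
  refine ⟨1, zero_le_one, fun ε hε0 hε1 ↦ ?_⟩
  -- Proposition 1 and the extension lemma with `C = 1`, `C_L = 2`, `A = M`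
  obtain ⟨B₁, hB₁⟩ := hP1 hRH c ε 1 2 M hc0 hc1 hε0 hε1 one_pos two_pos hM0 w
  obtain ⟨B₂, hB₂⟩ := hExt c ε 1 2 M hc0 hε0 hε1 one_pos two_pos hM0 w
  refine ⟨max B₁ B₂, fun B hB ↦ ?_⟩
  obtain ⟨K₁, hK₁⟩ := hB₁ B ((le_max_left _ _).trans hB)
  obtain ⟨KE, T₂, hKE⟩ := hB₂ B ((le_max_right _ _).trans hB)
  -- Theorem 4 (relative form; its presupposition is `hSI`)
  obtain ⟨A₄, hA₄0, hA₄⟩ := hT4 c hc0 w B ρ hSI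
  -- (3) and `C_Φ > 0`
  obtain ⟨K₃, hK₃⟩ := hW w B
  have hCΦ : 0 < cPhi w B := hC w B
  -- the `O(1/√log 𝓔)`-constant of (8)
  set κ : ℝ := 4 * |SI| / (π * D) with hκ_def
  have hκ0 : 0 ≤ κ := by positivity
  refine ⟨κ * A₄, by positivity, fun η hη ↦ ?_⟩
  -- tolerances
  set η₁ : ℝ := η / 5 with hη₁_def
  have hη₁0 : 0 < η₁ := by positivity
  set η₃ : ℝ := min (1 / 2) (η / (5 * (κ + 1))) with hη₃_def
  have hη₃0 : 0 < η₃ := lt_min (by norm_num) (by positivity)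
  have hη₃half : η₃ ≤ 1 / 2 := min_le_left _ _
  have hη₃κ : κ * η₃ ≤ η / 5 := by
    have h1 : η₃ ≤ η / (5 * (κ + 1)) := min_le_right _ _
    calc κ * η₃ ≤ κ * (η / (5 * (κ + 1))) := by gcongr
      _ ≤ (κ + 1) * (η / (5 * (κ + 1))) := by gcongr; linarith
      _ = η / 5 := by field_simp
  set η₄ : ℝ := η / (5 * (κ + 1)) with hη₄_def
  have hη₄0 : 0 < η₄ := by positivity
  have hη₄κ : κ * η₄ ≤ η / 5 := by
    calc κ * η₄ ≤ (κ + 1) * (η / (5 * (κ + 1))) := by rw [hη₄_def]; gcongr; linarith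
      _ = η / 5 := by field_simp
  obtain ⟨T₁, hT₁⟩ := hK₁ η₁ hη₁0
  obtain ⟨q₃, hq₃⟩ := hT3 w B ρ η₃ hη₃0
  obtain ⟨q₄, hq₄⟩ := hA₄ η₄ hη₄0
  -- eventual conditions in `q`
  have hTend := Assembly.tendsto_T ρ
  have hTdiv := tendsto_T_div ρ
  have hev : ∀ᶠ q : ℕ in atTop, q₃ ≤ q ∧ q₄ ≤ q ∧ 2 ≤ q ∧ T₁ ≤ ρ.T q ∧ T₂ ≤ ρ.T q ∧
      1 ≤ ρ.T q ∧ 5 * |K₁| / η ≤ ρ.T q ∧ 5 * |KE| / η ≤ ρ.T q ∧ 2 * K₃ / cPhi w B ≤ ρ.T q ∧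
      8 / (D * cPhi w B) ≤ ρ.T q / q := by
    filter_upwards [eventually_ge_atTop q₃, eventually_ge_atTop q₄, eventually_ge_atTop 2,
      hTend.eventually_ge_atTop T₁, hTend.eventually_ge_atTop T₂, hTend.eventually_ge_atTop 1,
      hTend.eventually_ge_atTop (5 * |K₁| / η), hTend.eventually_ge_atTop (5 * |KE| / η),
      hTend.eventually_ge_atTop (2 * K₃ / cPhi w B),
      hTdiv.eventually_ge_atTop (8 / (D * cPhi w B))] with q h1 h2 h3 h4 h5 h6 h7 h8 h9 h10
    exact ⟨h1, h2, h3, h4, h5, h6, h7, h8, h9, h10⟩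
  obtain ⟨Q, hQ⟩ := Filter.eventually_atTop.mp hev
  refine ⟨Q, fun q _ χ E hQq hSiegel ↦ ?_⟩
  obtain ⟨hqq₃, hqq₄, hq2, hT₁q, hT₂q, hT1q, hK₁q, hKEq, hK₃q, hDq⟩ := hQ q hQq
  have hq1 : 1 ≤ q := by omega
  have hq0 : (0 : ℝ) < q := by exact_mod_cast (by omega : 0 < q)
  obtain ⟨hL1, hLT⟩ := lengthL_le_T_sq ρ hq1
  have hcoef : ∀ n : ℕ, 1 ≤ n → |ρ.coeff χ n| ≤ M * (n : ℝ) ^ ε := fun n hn ↦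
    (hM q χ n hq1 hn).trans (le_mul_of_one_le_right hM0 (Real.one_le_rpow (by exact_mod_cast hn) hε0.le))
  -- the four inputs at this `q`
  have h1 := hT₁ (ρ.T q) hT₁q (lengthL q) hL1 hLT (ρ.coeff χ) hcoef
  have h3 := hq₃ q χ hqq₃ hSiegel.1 hSiegel.2.1
  have h4 := hq₄ q χ E hqq₄ hSiegel
  have hExtq := hKE (ρ.T q) hT₂q (lengthL q) hL1 hLT (ρ.coeff χ) hcoef
  have hK₃T := hK₃ (ρ.T q) hT1q
  have hI0main : I0main w B ρ q =
      D * (weightHat w B (ρ.T q) 0 * ((Nat.totient q : ℝ) / q) * Real.log (lengthL q)) := by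
    rw [hD_def, I0main]; ring
  have hJmain : Jmain c w B ρ q =
      (weightHat w B (ρ.T q) 0 * ((Nat.totient q : ℝ) / q) * Real.log (lengthL q)) * SI := rfl
  -- abbreviations
  set T : ℝ := ρ.T q with hT_def
  set L : ℝ := lengthL q with hL_def
  set r : ℕ → ℝ := ρ.coeff χ with hr_def
  set Sc : ℝ := weightHat w B T 0 * ((Nat.totient q : ℝ) / q) * Real.log L with hSc_def
  have hT0 : 0 < T := by linarith
  -- `Ŵ_T(0) ≥ C_Φ T/2`, hence `Sc ≥ (C_Φ T/2)(1/q)·1`, hence `D·Sc ≥ 2`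
  have hW0low : cPhi w B * T / 2 ≤ weightHat w B T 0 := by
    have h2K : 2 * K₃ ≤ cPhi w B * T := by
      have := (div_le_iff₀ hCΦ).mp hK₃q
      linarith
    have hCT : 0 ≤ cPhi w B * T / 2 := by positivity
    have hKT : K₃ * T⁻¹ ≤ cPhi w B * T / 2 := by
      rw [inv_eq_one_div, ← mul_div_assoc, mul_one, div_le_iff₀ hT0]
      calc K₃ ≤ cPhi w B * T / 2 := by linarith
        _ = cPhi w B * T / 2 * 1 := (mul_one _).symm
        _ ≤ cPhi w B * T / 2 * T := mul_le_mul_of_nonneg_left hT1q hCT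
    have := (abs_le.mp hK₃T).1
    linarith
  have hWnn : 0 ≤ weightHat w B T 0 := le_trans (by positivity) hW0low
  have hφq : (1 : ℝ) / q ≤ (Nat.totient q : ℝ) / q := by
    gcongr
    exact_mod_cast Nat.totient_pos.mpr (by omega)
  have hlogL : 1 ≤ Real.log L := by
    rw [hL_def, lengthL, Real.log_rpow hq0]
    have hlog2q : Real.log 2 ≤ Real.log q := Real.log_le_log two_pos (by exact_mod_cast hq2)
    have h2 : (0.6931471803 : ℝ) < Real.log 2 := Real.log_two_gt_d9
    linarith
  have hSc_low : cPhi w B * T / 2 * (1 / q) * 1 ≤ Sc := by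
    have s2 : cPhi w B * T / 2 * (1 / q) ≤ weightHat w B T 0 * ((Nat.totient q : ℝ) / q) :=
      mul_le_mul hW0low hφq (by positivity) hWnn
    exact mul_le_mul s2 hlogL zero_le_one (mul_nonneg hWnn (by positivity))
  have hSc_pos : 0 < Sc := lt_of_lt_of_le (by positivity) hSc_low
  have hDSc2 : 2 ≤ D * Sc := by
    have hC0 : cPhi w B ≠ 0 := hCΦ.ne'
    have hD0 : D ≠ 0 := hDpos.ne'
    have h4 : 4 ≤ D * cPhi w B / 2 * (T / q) := by
      have h1 : D * cPhi w B / 2 * (8 / (D * cPhi w B)) = 4 := by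
        field_simp; norm_num
      rw [← h1]
      exact mul_le_mul_of_nonneg_left hDq (by positivity)
    have hval : D * (cPhi w B * T / 2 * (1 / q) * 1) = D * cPhi w B / 2 * (T / q) := by ring
    have h5 := mul_le_mul_of_nonneg_left hSc_low hDpos.le
    rw [hval] at h5
    linarith
  -- Theorem 3 at this `q`: `|I₀ − D·Sc| ≤ η₃·D·Sc`, so `I₀ ≥ 1`
  rw [hI0main] at h3
  have hI0one : 1 ≤ I0R w B r L T := by
    have h := (abs_le.mp h3).1
    have hDS : 0 < D * Sc := by positivity
    have h' : η₃ * (D * Sc) ≤ 1 / 2 * (D * Sc) := mul_le_mul_of_nonneg_right hη₃half hDS.le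
    linarith
  -- the extension lemma at this `q`
  obtain ⟨hI0pos, hExt'⟩ := hExtq hI0one
  -- Proposition 1's `O_ε(T^{-1})` and the extension's `O(T^{-1})` are `≤ η/5` each
  have hTinv : T ^ (-(1 : ℝ)) = T⁻¹ := by rw [Real.rpow_neg hT0.le, Real.rpow_one]
  have hK₁T : |K₁| * T⁻¹ ≤ η / 5 := by
    have h' : 5 * |K₁| ≤ η * T := by
      have := (div_le_iff₀ hη).mp hK₁q; linarith
    rw [mul_inv_le_iff₀ hT0]; linarith
  have hKET : |KE| * T⁻¹ ≤ η / 5 := by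
    have h' : 5 * |KE| ≤ η * T := by
      have := (div_le_iff₀ hη).mp hKEq; linarith
    rw [mul_inv_le_iff₀ hT0]; linarith
  have h1' : |I1R c w B r L T - (c * I0R w B r L T - 2 / π * primeSum c w B r L T)| ≤
      ε * I0R w B r L T + η₁ * I0R w B r L T + |K₁| * T⁻¹ := by
    refine h1.trans ?_
    rw [hTinv]
    gcongr
    exact le_abs_self K₁
  -- Theorem 4 at this `q`, in the shape of `ratio_core`
  have hJ : J c w B ρ χ = primeSum c w B r L T := rfl
  rw [hJmain, hJ] at h4
  have h4' : |primeSum c w B r L T + Sc * SI| ≤ (η₄ + A₄ / Real.sqrt (Real.log E)) * |Sc * SI| := h4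
  have he₄ : 0 ≤ η₄ + A₄ / Real.sqrt (Real.log E) := by positivity
  -- the core inequality for `I₁/I₀`
  have hcore := ratio_core hDpos hSc_pos hη₃0.le hη₃half he₄ (by positivity) hI0one h3 h1' h4'
  -- combine with the extension lemma
  have hExt'' : |I1 c ε w B r L T / I0 ε w B r L T - I1R c w B r L T / I0R w B r L T| ≤ |KE| * T⁻¹ := by
    refine hExt'.trans ?_
    rw [hTinv]; gcongr; exact le_abs_self KE
  have hmain : mainTerm8 ρ.δ c ρ.G₀ = c + 2 / (π * D) * SI := rfl
  have htri := abs_sub_le (I1 c ε w B r L T / I0 ε w B r L T) (I1R c w B r L T / I0R w B r L T)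
    (c + 2 / (π * D) * SI)
  have hsplit : κ * A₄ / Real.sqrt (Real.log E) = κ * (A₄ / Real.sqrt (Real.log E)) :=
    mul_div_assoc _ _ _
  rw [hmain, hsplit]
  linarith [htri, hExt'', hcore, hη₃κ, hη₄κ, hK₁T, hKET]


end BondarenkoHeap2026

/-- **Bondarenko–Heap Theorem 1 from the typed internal statements of §2** (the cell's discharge
target for the apex claim): Proposition 1, Theorem 3, Theorem 4, `C_Φ > 0`, (3), the extension of
the integrals to `ℝ` and the numerical inequality behind (8) imply
`bondarenkoHeap2026_theorem1 : ∃ E₀ ≥ 10, SiegelZerosOfQuality E₀ → RiemannHypothesis →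
ZetaGapLiminfBelow 0.4733` — by `equation8_glue_holds` and `theorem1_assembly_holds`. The seven
antecedents are named facts of print (claims of the unrefereed source, resp. the "computer
calculation"); nothing here asserts them, RH, or the existence of Siegel zeros. NOT RH-BEARING.
[claim: BondarenkoHeap2026, status: under-review] -/
theorem bondarenkoHeap2026_theorem1_of_internal (h1 : BondarenkoHeap2026.proposition1)
    (h3 : BondarenkoHeap2026.theorem3) (h4 : BondarenkoHeap2026.theorem4)
    (hC : BondarenkoHeap2026.cPhi_pos) (hW : BondarenkoHeap2026.weightHat_zero)
    (hE : BondarenkoHeap2026.extensionToLine) (hN : BondarenkoHeap2026.numericalInequality8) :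
    bondarenkoHeap2026_theorem1 :=
  BondarenkoHeap2026.theorem1_assembly_holds (BondarenkoHeap2026.equation8_glue_holds h1 h3 h4 hC hW hE) hN

end Literature.NumberTheory.LFunctions

end
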